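import Literature.Barriers.CriticalPhenomena.LaceExpansionIsingAboveFourAudit
import Mathlib.Analysis.PSeries
import HarnessLib

/-!
# Towards `LaceExpansionIsingAboveFourNarrow`: divergence of the bubble diagram on `ℤ³` and `ℤ⁴`
# from the reflected-current inequality and the gradient estimate (Duminil-Copin–Panis 2025, Thm 1.8)

Barrier catalogue `Literature/Barriers/CriticalPhenomena/` (D-0021), proof companion of
`LaceExpansionIsingAboveFour.lean`. The corrected barrier

`LaceExpansionIsingAboveFourNarrow := (¬ NNIsing.BubbleCondition 3 ∧ ¬ NNIsing.BubbleCondition 4) ∧ SpreadOutIsing.Sakai2007_thm13_spreadOut`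

has two conjuncts: (N2) is the named fact `SpreadOutIsing.Sakai2007_thm13_spreadOut` (Sakai 2007,
Thm. 1.3, spread-out model), whose discharge is a separate programme of the tree
(`LaceExpansionIsingDeconvolution*.lean`); (N1) is Duminil-Copin–Panis, CMP 406 (2025) =
arXiv:2404.05700, **Theorem 1.8**: "Let `d = 3, 4`. Then `B(β_c) = ∞`" for the nearest-neighbour
Ising model. This file proves the ANALYTIC half of the printed proof of Theorem 1.8 (§1.2,
"Divergence of the bubble diagram", pp. 6–7 of the arXiv version) for an abstract nonnegative
lattice function `G` (to be `x ↦ ⟨σ₀σ_x⟩^f_{β_c}`) enjoying the Messager–Miracle-Solé monotonicity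
and symmetry properties, and specialises it to the nearest-neighbour model:

*if `G` satisfies (H1) the reflected-current inequality of DCP Theorem 1.2 at `β_c` along the axis
`i` — `c₀ ≤ ∑_{x,y ∈ Λ_n, y ∼ x} (G(x) - G(R_n x)) G(y - R_n y)` for all large `n`, `R_n` the
reflection `y_i ↦ 2n - y_i` — and (H2) the gradient estimate
`G(x) - G(x + e_i) ≤ G(j e_i)/(x_i - j + 1)` (`0 ≤ j ≤ x_i`; the tree's rendering of the
"gradient estimate" (1.11), obtained in the source from the spectral representation), then
`Σ_x G(x)² = ∞` in `d = 3` and in `d = 4`* (`DCPBubble.not_summable_sq_three`,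
`DCPBubble.not_summable_sq_four`), whence **`NNIsing.not_bubbleCondition_of_dcp`**: for the
nearest-neighbour Ising model on `ℤ^d`, `d ∈ {3, 4}`, (H1) and (H2) for
`twoPointFree d (criticalBeta d)` imply `¬ NNIsing.BubbleCondition d`, every Messager–Miracle-Solé
input being a theorem of the tree (`messager_miracleSole_free`,
`twoPointFree_diagAxis_le_of_mem_sphere'`, `twoPointFree_abs_eq`, `twoPointFree_single_eq_single`).

The printed proof (p. 7): assume `B(β_c) < ∞`; split the sum of Theorem 1.2 according to
`x₁ ≤ n/2` or `x₁ > n/2`; the first part tends to `0` (Cauchy–Schwarz and the tail of the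
bubble: `firstHalf_le`, `firstHalf_small`); in the second part the gradient estimate and the MMS
inequalities give `c₁ ≤ C n^{d-2} ⟨σ₀σ_{(n/4)e₁}⟩ ∑_{k ≤ n} k ⟨σ₀σ_{ke₁}⟩` (`secondHalf_le`,
`tsum_shift_le`, `axisSum_le_coarse`), and Cauchy–Schwarz once more gives
`∑_{k ≤ n} k⟨σ₀σ_{ke₁}⟩ ≤ C√n √B` (`d = 3`), `≤ C √(log n) √B` (`d = 4`), whence
`⟨σ₀σ_{(n/4)e₁}⟩ ≥ c n^{-3/2}` (`d = 3`), `≥ c/(n² √(log n))` (`d = 4`) (`axis_lower_bound`),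
contradicting `B(β_c) < ∞` (shell sums `≍ 1/n`, resp. `1/(n log n)`, are not summable). Our
rendering follows this line with explicit constants; in `d = 4` the harmonic numbers
`H_N = ∑_{m<N} 1/(m+1)` replace `log n` and the divergence of `∑ 1/(n H_{16n+1})` is Cauchy
condensation (`summable_condensed_iff_of_nonneg`, `not_summable_of_harmonic_lower`).

(H1) is DCP Theorem 1.2 at `β = β_c` (where `n ≤ L(β_c) = ∞` is automatic, Duminil-Copin–Tassion's
`β̃_c = β_c`, the tree's `one_le_dctIsingPhi_of_criticalBeta_le`); (H2) is the gradient estimate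
(1.11). Both remain hypotheses here and are the subject of sequel files (reflected random currents
on the torus, resp. reflection positivity). Nothing here is a named fact; no definition is
introduced (D-0026).

## References

* H. Duminil-Copin, R. Panis, *New lower bounds for the (near) critical Ising and φ⁴ models'
  two-point functions*, Comm. Math. Phys. 406 (2025), arXiv:2404.05700, Theorems 1.2, 1.3, 1.8
  and §1.2 [DuminilCopinPanis2025LowerBounds].
* A. Messager, S. Miracle-Solé, J. Stat. Phys. 17 (1977) 245 [MessagerMiracleSoleJSP1977].
* H. Duminil-Copin, *Lectures on the Ising and Potts models on the hypercubic lattice* (2019),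
  §4.3, eq. (4.10) [DuminilCopin2019].
-/

noncomputable section

open Filter Finset
open Literature.Probability.LatticeModels Literature.Probability.Percolation
open scoped BigOperators ENNReal Topology

namespace Literature.Barriers.CriticalPhenomena

namespace DCPBubble

open EtaCriterion

variable {d : ℕ}

/-! ### Coordinates of the axis reflection `R = axisRefl i c : y_i ↦ c - y_i` -/

/-- `y - R y = (2y_i - c) e_i`. [folklore] -/
theorem sub_axisRefl_eq_single (i : Fin d) (c : ℤ) (y : Site d) :
    y - axisRefl i c y = Pi.single i (2 * y i - c) := by
  funext j
  rw [Pi.sub_apply, axisRefl_apply]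
  by_cases hj : j = i
  · subst hj; simp; ring
  · simp [hj]

/-- `R x = x + (c - 2x_i) e_i`. [folklore] -/
theorem axisRefl_eq_add_single (i : Fin d) (c : ℤ) (x : Site d) :
    axisRefl i c x = x + Pi.single i (c - 2 * x i) := by
  funext j
  rw [Pi.add_apply, axisRefl_apply]
  by_cases hj : j = i
  · subst hj; simp; ring
  · simp [hj]

/-- Neighbours in `ℤ^d` have `i`-th coordinates differing by at most one. [folklore] -/
theorem coord_le_add_one_of_adj {x y : Site d} (h : (zdGraph d).Adj x y) (i : Fin d) :
    y i ≤ x i + 1 ∧ x i ≤ y i + 1 := by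
  obtain ⟨j, h | h⟩ := (zdGraph_adj_iff x y).1 h
  · rw [h]
    by_cases hij : i = j
    · subst hij; simp only [Pi.add_apply, Pi.single_eq_same]; omega
    · simp [Pi.single_eq_of_ne hij]
  · rw [h]
    by_cases hij : i = j
    · subst hij; simp only [Pi.add_apply, Pi.single_eq_same]; omega
    · simp [Pi.single_eq_of_ne hij]

/-- At most `2d` neighbours of `x` lie in any finite set. [folklore] -/
theorem card_filter_adj_le (s : Finset (Site d)) (x : Site d) :
    #(s.filter fun y => (zdGraph d).Adj x y) ≤ 2 * d := by
  calc #(s.filter fun y => (zdGraph d).Adj x y) ≤ #((zdGraph d).neighborFinset x) := by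
        refine card_le_card fun y hy => ?_
        rw [SimpleGraph.mem_neighborFinset]
        exact (mem_filter.1 hy).2
    _ = 2 * d := card_neighborFinset_zdGraph_holds x

/-- Fibre sums over the box: `∑_{x ∈ Λ_n} h(x_i) = (2n+1)^{d-1} ∑_{v=-n}^{n} h(v)`. [folklore] -/
theorem sum_box_comp_coord (i : Fin d) (n : ℕ) (h : ℤ → ℝ) :
    ∑ x ∈ box d n, h (x i) = (2 * n + 1 : ℝ) ^ (d - 1) * ∑ v ∈ Icc (-(n : ℤ)) n, h v := by
  classical
  set g : Fin d → ℤ → ℝ := fun j v => if j = i then h v else 1 with hg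
  have h1 : ∀ x : Site d, ∏ j, g j (x j) = h (x i) := fun x => by
    rw [hg]
    simp only
    rw [Finset.prod_ite_eq']
    simp
  have h2 : ∏ j : Fin d, ∑ v ∈ Icc (-(n : ℤ)) n, g j v =
      (2 * n + 1 : ℝ) ^ (d - 1) * ∑ v ∈ Icc (-(n : ℤ)) n, h v := by
    have hsum : ∀ j : Fin d, ∑ v ∈ Icc (-(n : ℤ)) n, g j v =
        if j = i then ∑ v ∈ Icc (-(n : ℤ)) n, h v else (2 * n + 1 : ℝ) := fun j => by
      by_cases hj : j = i
      · simp [hg, hj]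
      · simp only [hg, hj, if_false, sum_const, nsmul_eq_mul, mul_one, Int.card_Icc]
        rw [show (n : ℤ) + 1 - -(n : ℤ) = ((2 * n + 1 : ℕ) : ℤ) by push_cast; ring, Int.toNat_natCast]
        push_cast; ring
    simp_rw [hsum]
    rw [Finset.prod_ite, Finset.prod_const, Finset.prod_const]
    have hc1 : #(univ.filter fun j : Fin d => j = i) = 1 := by
      rw [Finset.filter_eq', if_pos (mem_univ i), card_singleton]
    have hc2 : #(univ.filter fun j : Fin d => ¬ j = i) = d - 1 := by
      have := Finset.card_filter_add_card_filter_not (s := (univ : Finset (Fin d)))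
        (fun j : Fin d => j = i)
      rw [hc1, card_univ, Fintype.card_fin] at this
      omega
    rw [hc1, hc2, pow_one, mul_comm]
  rw [← h2, ← Finset.sum_prod_piFinset]
  simp_rw [h1]
  rfl

/-! ### Axis values of an even lattice function that is nonincreasing along the axis -/

section Axis

variable {G : Site d → ℝ} {i : Fin d}

/-- Iterated axis monotonicity: `G(x + m e_i) ≤ G(x)` for `x_i ≥ 0`, `m ∈ ℕ`.
[cite: MessagerMiracleSoleJSP1977, main theorem (monotonicity of ⟨σ₀σ_x⟩ under reflections)] -/
theorem apply_add_single_le (hmono : ∀ x : Site d, 0 ≤ x i → G (x + Pi.single i 1) ≤ G x)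
    (x : Site d) (hx : 0 ≤ x i) (m : ℕ) : G (x + Pi.single i (m : ℤ)) ≤ G x := by
  induction m with
  | zero => simp
  | succ m ih =>
      have h := hmono (x + Pi.single i (m : ℤ)) (by simp; omega)
      have heq : x + Pi.single i (m : ℤ) + Pi.single i 1 = x + Pi.single i (((m + 1 : ℕ) : ℤ)) := by
        rw [add_assoc, ← Pi.single_add]; push_cast; rfl
      rw [heq] at h
      exact h.trans ih

/-- The axis values `k ↦ G(k e_i)` are nonincreasing on `k ≥ 0`.
[cite: MessagerMiracleSoleJSP1977, main theorem (monotonicity of ⟨σ₀σ_x⟩ under reflections)] -/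
theorem axis_le_axis (hmono : ∀ x : Site d, 0 ≤ x i → G (x + Pi.single i 1) ≤ G x)
    {k l : ℤ} (hk : 0 ≤ k) (hkl : k ≤ l) :
    G (Pi.single i l) ≤ G (Pi.single i k) := by
  obtain ⟨m, rfl⟩ : ∃ m : ℕ, l = k + m := ⟨(l - k).toNat, by omega⟩
  have h := apply_add_single_le hmono (Pi.single i k) (by simp [hk]) m
  rwa [← Pi.single_add] at h

/-- Evenness on the axis: `G(-k e_i) = G(k e_i)`. [folklore] -/
theorem axis_neg (hGev : ∀ x : Site d, G (-x) = G x) (k : ℤ) :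
    G (Pi.single i (-k)) = G (Pi.single i k) := by
  rw [← hGev (Pi.single i k), ← Pi.single_neg]

/-- The factor `G(y - R_n y) = G(2(n - y_i) e_i)` of the reflected-current sum. [folklore] -/
theorem apply_sub_axisRefl (hGev : ∀ x : Site d, G (-x) = G x) (n : ℕ) (y : Site d) :
    G (y - axisRefl i (2 * n) y) = G (Pi.single i (2 * n - 2 * y i)) := by
  rw [sub_axisRefl_eq_single, show 2 * y i - 2 * (n : ℤ) = -(2 * n - 2 * y i) by ring, axis_neg hGev]

/-- **Telescoped gradient estimate**: `G(x) - G(x + m e_i) ≤ m · G(j e_i)/(x_i - j + 1)` for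
`0 ≤ j ≤ x_i` (DCP 2025, footnote to (1.11): "The estimate follows by telescoping").
[cite: DuminilCopinPanis2025LowerBounds, proof of Theorem 1.3, eq. (1.11)] -/
theorem sub_apply_add_le_of_grad (hG0 : ∀ x, 0 ≤ G x)
    (hgrad : ∀ (x : Site d) (j : ℕ), (j : ℤ) ≤ x i →
      G x - G (x + Pi.single i 1) ≤ G (Pi.single i (j : ℤ)) / ((x i : ℝ) - j + 1))
    (x : Site d) (j : ℕ) (hj : (j : ℤ) ≤ x i) (m : ℕ) :
    G x - G (x + Pi.single i (m : ℤ)) ≤ m * (G (Pi.single i (j : ℤ)) / ((x i : ℝ) - j + 1)) := by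
  induction m with
  | zero => simp
  | succ m ih =>
      set x' : Site d := x + Pi.single i (m : ℤ) with hx'
      have hx'i : x' i = x i + m := by simp [hx']
      have hstep := hgrad x' j (by rw [hx'i]; omega)
      have heq : x' + Pi.single i 1 = x + Pi.single i (((m + 1 : ℕ) : ℤ)) := by
        rw [hx', add_assoc, ← Pi.single_add]; push_cast; rfl
      rw [heq, hx'i] at hstep
      have hpos : (0 : ℝ) < (x i : ℝ) - j + 1 := by
        have : (j : ℝ) ≤ (x i : ℝ) := by exact_mod_cast hj
        linarith
      have hden : G (Pi.single i (j : ℤ)) / (((x i + m : ℤ) : ℝ) - j + 1) ≤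
          G (Pi.single i (j : ℤ)) / ((x i : ℝ) - j + 1) := by
        refine div_le_div_of_nonneg_left (hG0 _) hpos ?_
        push_cast; linarith [(Nat.cast_nonneg m : (0 : ℝ) ≤ m)]
      push_cast
      calc G x - G (x + Pi.single i ((m : ℤ) + 1))
          = (G x - G x') + (G x' - G (x + Pi.single i (((m + 1 : ℕ) : ℤ)))) := by push_cast; ring
        _ ≤ m * (G (Pi.single i (j : ℤ)) / ((x i : ℝ) - j + 1)) +
              G (Pi.single i (j : ℤ)) / ((x i : ℝ) - j + 1) := add_le_add ih (hstep.trans hden)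
        _ = (m + 1 : ℝ) * (G (Pi.single i (j : ℤ)) / ((x i : ℝ) - j + 1)) := by ring

/-- **The gradient across the reflection** (DCP 2025, eq. (1.11) applied as in (1.12)): for
`x ∈ Λ_n` with `x_i > n/2`,
`G(x) - G(R_n x) ≤ 8 (n - x_i)/n · G(⌊n/4⌋ e_i)`.
[cite: DuminilCopinPanis2025LowerBounds, proof of Theorem 1.3, eqs. (1.11)–(1.12)] -/
theorem sub_apply_axisRefl_le (hG0 : ∀ x, 0 ≤ G x)
    (hgrad : ∀ (x : Site d) (j : ℕ), (j : ℤ) ≤ x i →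
      G x - G (x + Pi.single i 1) ≤ G (Pi.single i (j : ℤ)) / ((x i : ℝ) - j + 1))
    {n : ℕ} {x : Site d} (hxn : x i ≤ n) (hx : (n : ℤ) < 2 * x i) :
    G x - G (axisRefl i (2 * n) x) ≤
      8 * (((n : ℤ) - x i : ℤ) : ℝ) / n * G (Pi.single i ((n / 4 : ℕ) : ℤ)) := by
  set j : ℕ := n / 4 with hj
  set m : ℕ := (2 * ((n : ℤ) - x i)).toNat with hm
  have hm' : (m : ℤ) = 2 * ((n : ℤ) - x i) := by rw [hm]; omega
  have hR : axisRefl i (2 * n) x = x + Pi.single i (m : ℤ) := by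
    rw [axisRefl_eq_add_single, hm']; congr 1; congr 1; ring
  have hjx : (j : ℤ) ≤ x i := by rw [hj]; omega
  have hn1 : (1 : ℝ) ≤ n := by exact_mod_cast (show 1 ≤ n by omega)
  have htel := sub_apply_add_le_of_grad hG0 hgrad x j hjx m
  rw [hR]
  refine htel.trans ?_
  have hmR : (m : ℝ) = 2 * (((n : ℤ) - x i : ℤ) : ℝ) := by exact_mod_cast hm'
  have ha0 : 0 ≤ G (Pi.single i (j : ℤ)) := hG0 _
  -- the denominator is at least `n/4`
  have hden : (n : ℝ) / 4 ≤ (x i : ℝ) - j + 1 := by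
    have h1 : ((n : ℝ) + 1) / 2 ≤ (x i : ℝ) := by
      have : (n : ℤ) + 1 ≤ 2 * x i := by omega
      have : ((n : ℝ) + 1) ≤ 2 * (x i : ℝ) := by exact_mod_cast this
      linarith
    have h2 : (j : ℝ) ≤ (n : ℝ) / 4 := by
      rw [hj]; exact Nat.cast_div_le
    linarith
  have hpos : (0 : ℝ) < (n : ℝ) / 4 := by positivity
  have hnx : (0 : ℝ) ≤ (((n : ℤ) - x i : ℤ) : ℝ) := by exact_mod_cast (show (0 : ℤ) ≤ n - x i by omega)
  calc (m : ℝ) * (G (Pi.single i (j : ℤ)) / ((x i : ℝ) - j + 1))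
      ≤ (m : ℝ) * (G (Pi.single i (j : ℤ)) / ((n : ℝ) / 4)) := by
        refine mul_le_mul_of_nonneg_left (div_le_div_of_nonneg_left ha0 hpos hden) (Nat.cast_nonneg m)
    _ = 8 * (((n : ℤ) - x i : ℤ) : ℝ) / n * G (Pi.single i (j : ℤ)) := by
        rw [hmR]; field_simp; ring

end Axis

/-! ### The two halves of the reflected-current sum (DCP 2025, proof of Theorem 1.8) -/

section Split

variable {G : Site d → ℝ} {i : Fin d}

/-- **First half, pointwise** (`x_i ≤ n/2`): by the MMS monotonicity,
`(G(x) - G(R_n x)) G(y - R_n y) ≤ G(x) G((n-2) e_i)` for `y ∼ x` in `Λ_n`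
(DCP 2025, first display of the proof of Thm. 1.3 / (1.14)). [cite: DuminilCopinPanis2025LowerBounds, proof of Theorem 1.8, eq. (1.14)] -/
theorem term_le_of_two_mul_le (hG0 : ∀ x, 0 ≤ G x) (hGev : ∀ x : Site d, G (-x) = G x)
    (hmono : ∀ x : Site d, 0 ≤ x i → G (x + Pi.single i 1) ≤ G x)
    {n : ℕ} (hn : 2 ≤ n) {x y : Site d} (hx : 2 * x i ≤ (n : ℤ)) (hxy : (zdGraph d).Adj x y) :
    (G x - G (axisRefl i (2 * n) x)) * G (y - axisRefl i (2 * n) y) ≤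
      G x * G (Pi.single i ((n : ℤ) - 2)) := by
  have hyc := (coord_le_add_one_of_adj hxy i).1
  rw [apply_sub_axisRefl hGev]
  have hle : G (Pi.single i (2 * (n : ℤ) - 2 * y i)) ≤ G (Pi.single i ((n : ℤ) - 2)) :=
    axis_le_axis hmono (by omega) (by omega)
  have hg0 : 0 ≤ G (Pi.single i (2 * (n : ℤ) - 2 * y i)) := hG0 _
  calc (G x - G (axisRefl i (2 * n) x)) * G (Pi.single i (2 * (n : ℤ) - 2 * y i))
      ≤ G x * G (Pi.single i (2 * (n : ℤ) - 2 * y i)) := by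
        refine mul_le_mul_of_nonneg_right ?_ hg0
        linarith [hG0 (axisRefl i (2 * n) x)]
    _ ≤ G x * G (Pi.single i ((n : ℤ) - 2)) := mul_le_mul_of_nonneg_left hle (hG0 x)

/-- **First half, summed**: `T¹_n ≤ 2d · G((n-2)e_i) · ∑_{x ∈ Λ_n} G(x)`.
[cite: DuminilCopinPanis2025LowerBounds, proof of Theorem 1.8, eq. (1.14)] -/
theorem firstHalf_le (hG0 : ∀ x, 0 ≤ G x) (hGev : ∀ x : Site d, G (-x) = G x)
    (hmono : ∀ x : Site d, 0 ≤ x i → G (x + Pi.single i 1) ≤ G x)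
    {n : ℕ} (hn : 2 ≤ n) :
    ∑ x ∈ (box d n).filter (fun x : Site d => 2 * x i ≤ (n : ℤ)),
        ∑ y ∈ (box d n).filter (fun y => (zdGraph d).Adj x y),
          (G x - G (axisRefl i (2 * n) x)) * G (y - axisRefl i (2 * n) y) ≤
      2 * d * G (Pi.single i ((n : ℤ) - 2)) * ∑ x ∈ box d n, G x := by
  have hA0 : 0 ≤ G (Pi.single i ((n : ℤ) - 2)) := hG0 _
  calc ∑ x ∈ (box d n).filter (fun x : Site d => 2 * x i ≤ (n : ℤ)),
          ∑ y ∈ (box d n).filter (fun y => (zdGraph d).Adj x y),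
            (G x - G (axisRefl i (2 * n) x)) * G (y - axisRefl i (2 * n) y)
      ≤ ∑ x ∈ (box d n).filter (fun x : Site d => 2 * x i ≤ (n : ℤ)), 2 * d * G (Pi.single i ((n : ℤ) - 2)) * G x := by
        refine sum_le_sum fun x hx => ?_
        have hx2 := (mem_filter.1 hx).2
        calc ∑ y ∈ (box d n).filter (fun y => (zdGraph d).Adj x y),
              (G x - G (axisRefl i (2 * n) x)) * G (y - axisRefl i (2 * n) y)
            ≤ ∑ _y ∈ (box d n).filter (fun y => (zdGraph d).Adj x y),
                G x * G (Pi.single i ((n : ℤ) - 2)) :=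
              sum_le_sum fun y hy => term_le_of_two_mul_le hG0 hGev hmono hn hx2 (mem_filter.1 hy).2
          _ = #((box d n).filter (fun y => (zdGraph d).Adj x y)) * (G x * G (Pi.single i ((n : ℤ) - 2))) := by
              rw [sum_const, nsmul_eq_mul]
          _ ≤ (2 * d : ℝ) * (G x * G (Pi.single i ((n : ℤ) - 2))) := by
              refine mul_le_mul_of_nonneg_right ?_ (mul_nonneg (hG0 x) hA0)
              exact_mod_cast card_filter_adj_le (box d n) x
          _ = 2 * d * G (Pi.single i ((n : ℤ) - 2)) * G x := by ring
    _ ≤ ∑ x ∈ box d n, 2 * d * G (Pi.single i ((n : ℤ) - 2)) * G x :=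
        sum_le_sum_of_subset_of_nonneg (filter_subset _ _) fun x _ _ =>
          mul_nonneg (mul_nonneg (by positivity) hA0) (hG0 x)
    _ = 2 * d * G (Pi.single i ((n : ℤ) - 2)) * ∑ x ∈ box d n, G x := by rw [mul_sum]

/-- **Second half, pointwise** (`x_i > n/2`): gradient estimate and MMS monotonicity give
`(G(x) - G(R_n x)) G(y - R_n y) ≤ (8(n - x_i)/n · G(⌊n/4⌋e_i)) · G((2(n-x_i) - 2) e_i)` for
`y ∼ x` in `Λ_n` (DCP 2025, (1.12)). [cite: DuminilCopinPanis2025LowerBounds, proof of Theorem 1.3, eq. (1.12)] -/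
theorem term_le_of_lt_two_mul (hG0 : ∀ x, 0 ≤ G x) (hGev : ∀ x : Site d, G (-x) = G x)
    (hmono : ∀ x : Site d, 0 ≤ x i → G (x + Pi.single i 1) ≤ G x)
    (hgrad : ∀ (x : Site d) (j : ℕ), (j : ℤ) ≤ x i →
      G x - G (x + Pi.single i 1) ≤ G (Pi.single i (j : ℤ)) / ((x i : ℝ) - j + 1))
    {n : ℕ} {x y : Site d} (hxn : x i ≤ n) (hx : (n : ℤ) < 2 * x i) (hxy : (zdGraph d).Adj x y) :
    (G x - G (axisRefl i (2 * n) x)) * G (y - axisRefl i (2 * n) y) ≤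
      (8 * (((n : ℤ) - x i : ℤ) : ℝ) / n * G (Pi.single i ((n / 4 : ℕ) : ℤ))) *
        G (Pi.single i (2 * ((n : ℤ) - x i) - 2)) := by
  have hyc := (coord_le_add_one_of_adj hxy i).1
  have hD := sub_apply_axisRefl_le hG0 hgrad hxn hx
  set D : ℝ := 8 * (((n : ℤ) - x i : ℤ) : ℝ) / n * G (Pi.single i ((n / 4 : ℕ) : ℤ)) with hDdef
  have hnx : (0 : ℝ) ≤ (((n : ℤ) - x i : ℤ) : ℝ) := by exact_mod_cast (show (0 : ℤ) ≤ n - x i by omega)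
  have hD0 : 0 ≤ D := by rw [hDdef]; exact mul_nonneg (by positivity) (hG0 _)
  rw [apply_sub_axisRefl hGev]
  have hg0 : 0 ≤ G (Pi.single i (2 * (n : ℤ) - 2 * y i)) := hG0 _
  calc (G x - G (axisRefl i (2 * n) x)) * G (Pi.single i (2 * (n : ℤ) - 2 * y i))
      ≤ D * G (Pi.single i (2 * (n : ℤ) - 2 * y i)) := mul_le_mul_of_nonneg_right hD hg0
    _ ≤ D * G (Pi.single i (2 * ((n : ℤ) - x i) - 2)) := by
        by_cases hxi : x i = n
        · have : D = 0 := by rw [hDdef, hxi]; simp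
          rw [this, zero_mul, zero_mul]
        · refine mul_le_mul_of_nonneg_left (axis_le_axis hmono (by omega) (by omega)) hD0

/-- **Second half, summed**: with `W_n := ∑_{t ≤ n} t · G((2t-2) e_i)`,
`T²_n ≤ 2d (2n+1)^{d-1} · (8/n) G(⌊n/4⌋ e_i) · W_n` (DCP 2025, (1.12)–(1.13): the fibre over
`x_i = n - t` has `(2n+1)^{d-1}` sites, each with at most `2d` neighbours). [cite: DuminilCopinPanis2025LowerBounds, proof of Theorem 1.3, eqs. (1.12)–(1.13)] -/
theorem secondHalf_le (hG0 : ∀ x, 0 ≤ G x) (hGev : ∀ x : Site d, G (-x) = G x)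
    (hmono : ∀ x : Site d, 0 ≤ x i → G (x + Pi.single i 1) ≤ G x)
    (hgrad : ∀ (x : Site d) (j : ℕ), (j : ℤ) ≤ x i →
      G x - G (x + Pi.single i 1) ≤ G (Pi.single i (j : ℤ)) / ((x i : ℝ) - j + 1))
    (n : ℕ) :
    ∑ x ∈ (box d n).filter (fun x : Site d => ¬ 2 * x i ≤ (n : ℤ)),
        ∑ y ∈ (box d n).filter (fun y => (zdGraph d).Adj x y),
          (G x - G (axisRefl i (2 * n) x)) * G (y - axisRefl i (2 * n) y) ≤
      2 * d * (2 * n + 1 : ℝ) ^ (d - 1) * (8 / n * G (Pi.single i ((n / 4 : ℕ) : ℤ))) *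
        ∑ t ∈ range (n + 1), (t : ℝ) * G (Pi.single i (2 * (t : ℤ) - 2)) := by
  set a4 : ℝ := G (Pi.single i ((n / 4 : ℕ) : ℤ)) with ha4
  have ha40 : 0 ≤ a4 := hG0 _
  -- the fibre function
  set h : ℤ → ℝ := fun v => if (n : ℤ) < 2 * v then
      (8 * (((n : ℤ) - v : ℤ) : ℝ) / n * a4) * G (Pi.single i (2 * ((n : ℤ) - v) - 2)) else 0 with hh
  have hh0 : ∀ v : ℤ, v ≤ n → 0 ≤ h v := fun v hv => by
    rw [hh]; simp only
    split_ifs with hv'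
    · have : (0 : ℝ) ≤ (((n : ℤ) - v : ℤ) : ℝ) := by exact_mod_cast (show (0 : ℤ) ≤ n - v by omega)
      exact mul_nonneg (mul_nonneg (by positivity) ha40) (hG0 _)
    · exact le_rfl
  -- pointwise: inner sums are at most `2d · h(x_i)`
  have hinner : ∀ x ∈ (box d n).filter (fun x : Site d => ¬ 2 * x i ≤ (n : ℤ)),
      ∑ y ∈ (box d n).filter (fun y => (zdGraph d).Adj x y),
          (G x - G (axisRefl i (2 * n) x)) * G (y - axisRefl i (2 * n) y) ≤ 2 * d * h (x i) := by
    intro x hx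
    obtain ⟨hxb, hx2⟩ := mem_filter.1 hx
    have hxn : x i ≤ n := ((mem_box.1 hxb) i).2
    have hlt : (n : ℤ) < 2 * x i := by omega
    have hhx : h (x i) = (8 * (((n : ℤ) - x i : ℤ) : ℝ) / n * a4) * G (Pi.single i (2 * ((n : ℤ) - x i) - 2)) := by
      rw [hh]; simp only; rw [if_pos hlt]
    calc ∑ y ∈ (box d n).filter (fun y => (zdGraph d).Adj x y),
          (G x - G (axisRefl i (2 * n) x)) * G (y - axisRefl i (2 * n) y)
        ≤ ∑ _y ∈ (box d n).filter (fun y => (zdGraph d).Adj x y), h (x i) := by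
          refine sum_le_sum fun y hy => ?_
          rw [hhx]
          exact term_le_of_lt_two_mul hG0 hGev hmono hgrad hxn hlt (mem_filter.1 hy).2
      _ = #((box d n).filter (fun y => (zdGraph d).Adj x y)) * h (x i) := by rw [sum_const, nsmul_eq_mul]
      _ ≤ 2 * d * h (x i) := by
          refine mul_le_mul_of_nonneg_right ?_ (hh0 _ hxn)
          exact_mod_cast card_filter_adj_le (box d n) x
  -- sum over `x`: the filtered sum of `h (x i)` is the full box sum of `h (x i)`
  have hstep1 : ∑ x ∈ (box d n).filter (fun x : Site d => ¬ 2 * x i ≤ (n : ℤ)), 2 * d * h (x i) =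
      ∑ x ∈ box d n, 2 * d * h (x i) := by
    rw [Finset.sum_filter]
    refine sum_congr rfl fun x hx => ?_
    by_cases hx2 : 2 * x i ≤ (n : ℤ)
    · rw [if_neg (not_not.2 hx2), hh]
      simp only
      rw [if_neg (by omega), mul_zero]
    · rw [if_pos hx2]
  -- the fibre sum of `h` is bounded by the `t`-sum
  have hstep2 : ∑ v ∈ Icc (-(n : ℤ)) n, h v ≤
      (8 / n * a4) * ∑ t ∈ range (n + 1), (t : ℝ) * G (Pi.single i (2 * (t : ℤ) - 2)) := by
    rw [mul_sum]
    -- restrict to the support of `h`, then re-index by `t = n - v`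
    have hsupp : ∑ v ∈ Icc (-(n : ℤ)) n, h v =
        ∑ v ∈ (Icc (-(n : ℤ)) n).filter (fun v => (n : ℤ) < 2 * v),
          (8 * (((n : ℤ) - v : ℤ) : ℝ) / n * a4) * G (Pi.single i (2 * ((n : ℤ) - v) - 2)) := by
      rw [sum_filter]
    rw [hsupp]
    set φ : ℤ → ℕ := fun v => ((n : ℤ) - v).toNat with hφ
    have hinj : Set.InjOn φ ((Icc (-(n : ℤ)) n).filter (fun v => (n : ℤ) < 2 * v)) := by
      intro v hv w hw hvw
      simp only [coe_filter, Set.mem_setOf_eq, mem_Icc] at hv hw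
      simp only [hφ] at hvw
      omega
    have himg : ((Icc (-(n : ℤ)) n).filter (fun v => (n : ℤ) < 2 * v)).image φ ⊆ range (n + 1) := by
      intro t ht
      obtain ⟨v, hv, rfl⟩ := mem_image.1 ht
      simp only [mem_filter, mem_Icc] at hv
      simp only [hφ, mem_range]
      omega
    have hreidx : ∑ v ∈ (Icc (-(n : ℤ)) n).filter (fun v => (n : ℤ) < 2 * v),
          (8 * (((n : ℤ) - v : ℤ) : ℝ) / n * a4) * G (Pi.single i (2 * ((n : ℤ) - v) - 2)) =
        ∑ t ∈ ((Icc (-(n : ℤ)) n).filter (fun v => (n : ℤ) < 2 * v)).image φ,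
          8 / n * a4 * ((t : ℝ) * G (Pi.single i (2 * (t : ℤ) - 2))) := by
      rw [sum_image hinj]
      refine sum_congr rfl fun v hv => ?_
      simp only [mem_filter, mem_Icc] at hv
      have hφv : ((φ v : ℕ) : ℤ) = (n : ℤ) - v := by simp only [hφ]; omega
      have hφvR : ((φ v : ℕ) : ℝ) = (((n : ℤ) - v : ℤ) : ℝ) := by exact_mod_cast hφv
      rw [hφvR, hφv]; ring
    rw [hreidx]
    refine sum_le_sum_of_subset_of_nonneg himg fun t _ _ => ?_
    exact mul_nonneg (mul_nonneg (by positivity) ha40) (mul_nonneg (Nat.cast_nonneg t) (hG0 _))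
  calc ∑ x ∈ (box d n).filter (fun x : Site d => ¬ 2 * x i ≤ (n : ℤ)),
          ∑ y ∈ (box d n).filter (fun y => (zdGraph d).Adj x y),
            (G x - G (axisRefl i (2 * n) x)) * G (y - axisRefl i (2 * n) y)
      ≤ ∑ x ∈ (box d n).filter (fun x : Site d => ¬ 2 * x i ≤ (n : ℤ)), 2 * d * h (x i) := sum_le_sum hinner
    _ = ∑ x ∈ box d n, 2 * d * h (x i) := hstep1
    _ = 2 * d * ((2 * n + 1 : ℝ) ^ (d - 1) * ∑ v ∈ Icc (-(n : ℤ)) n, h v) := by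
        rw [← mul_sum, sum_box_comp_coord i n h]
    _ ≤ 2 * d * ((2 * n + 1 : ℝ) ^ (d - 1) *
          ((8 / n * a4) * ∑ t ∈ range (n + 1), (t : ℝ) * G (Pi.single i (2 * (t : ℤ) - 2)))) := by
        gcongr
    _ = _ := by ring

/-- The `t`-sum of the second half against the axis sum `W_n = ∑_{s ≤ n} s G(s e_i)`:
`∑_{t ≤ n} t G((2t-2)e_i) ≤ 1 + 2 W_n` (shift `t = s + 1`, `G(2s e_i) ≤ G(s e_i)`, `G ≤ 1`).
[cite: DuminilCopinPanis2025LowerBounds, proof of Theorem 1.8, eq. (1.15)] -/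
theorem tsum_shift_le (hG1 : ∀ x, G x ≤ 1) (hG0 : ∀ x, 0 ≤ G x)
    (hmono : ∀ x : Site d, 0 ≤ x i → G (x + Pi.single i 1) ≤ G x) (n : ℕ) :
    ∑ t ∈ range (n + 1), (t : ℝ) * G (Pi.single i (2 * (t : ℤ) - 2)) ≤
      1 + 2 * ∑ s ∈ range (n + 1), (s : ℝ) * G (Pi.single i (s : ℤ)) := by
  rw [Finset.sum_range_succ' (fun t => (t : ℝ) * G (Pi.single i (2 * (t : ℤ) - 2))), Nat.cast_zero,
    zero_mul, add_zero]
  have hterm : ∀ s ∈ range n, ((s + 1 : ℕ) : ℝ) * G (Pi.single i (2 * ((s + 1 : ℕ) : ℤ) - 2)) ≤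
      (if s = 0 then 1 else 0) + 2 * ((s : ℝ) * G (Pi.single i (s : ℤ))) := by
    intro s _
    have h2s : G (Pi.single i (2 * ((s + 1 : ℕ) : ℤ) - 2)) ≤ G (Pi.single i (s : ℤ)) := by
      have : (2 * ((s + 1 : ℕ) : ℤ) - 2) = 2 * (s : ℤ) := by push_cast; ring
      rw [this]
      exact axis_le_axis hmono (by positivity) (by omega)
    by_cases hs : s = 0
    · subst hs
      simp only [if_true, Nat.cast_zero, zero_mul, mul_zero, add_zero, zero_add, Nat.cast_one, one_mul]
      exact hG1 _
    · rw [if_neg hs, zero_add]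
      have hs1 : (1 : ℝ) ≤ s := by exact_mod_cast Nat.one_le_iff_ne_zero.2 hs
      set g := G (Pi.single i (2 * ((s + 1 : ℕ) : ℤ) - 2)) with hg
      have hg0 : 0 ≤ g := hG0 _
      have hsR : ((s + 1 : ℕ) : ℝ) = (s : ℝ) + 1 := by push_cast; ring
      rw [hsR]
      nlinarith [mul_nonneg (Nat.cast_nonneg s) (sub_nonneg.2 h2s), hG0 (Pi.single i (s : ℤ)),
        mul_nonneg (sub_nonneg.2 hs1) hg0]
  calc ∑ s ∈ range n, ((s + 1 : ℕ) : ℝ) * G (Pi.single i (2 * ((s + 1 : ℕ) : ℤ) - 2))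
      ≤ ∑ s ∈ range n, ((if s = 0 then 1 else 0) + 2 * ((s : ℝ) * G (Pi.single i (s : ℤ)))) :=
        sum_le_sum hterm
    _ = (∑ s ∈ range n, (if s = 0 then (1 : ℝ) else 0)) + 2 * ∑ s ∈ range n, (s : ℝ) * G (Pi.single i (s : ℤ)) := by
        rw [sum_add_distrib, mul_sum]
    _ ≤ 1 + 2 * ∑ s ∈ range (n + 1), (s : ℝ) * G (Pi.single i (s : ℤ)) := by
        refine add_le_add ?_ ?_
        · rw [sum_ite_eq' (range n) 0 (fun _ => (1 : ℝ))]
          split_ifs <;> norm_num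
        · refine mul_le_mul_of_nonneg_left ?_ (by norm_num)
          exact sum_le_sum_of_subset_of_nonneg (range_subset_range.2 (Nat.le_succ n)) fun s _ _ =>
            mul_nonneg (Nat.cast_nonneg s) (hG0 _)

/-- Coarsening the axis sum to multiples of `d`: with `Ã_m := G(dm e_i)`,
`∑_{k ≤ n} k G(k e_i) ≤ d² ∑_{m ≤ n} (m+1) Ã_m` (`G(k e_i) ≤ Ã_{⌊k/d⌋}`, at most `d` indices `k`
per value of `⌊k/d⌋`). [folklore] -/
theorem axisSum_le_coarse (hG0 : ∀ x, 0 ≤ G x)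
    (hmono : ∀ x : Site d, 0 ≤ x i → G (x + Pi.single i 1) ≤ G x) (hd : 1 ≤ d) (n : ℕ) :
    ∑ k ∈ range (n + 1), (k : ℝ) * G (Pi.single i (k : ℤ)) ≤
      (d : ℝ) ^ 2 * ∑ m ∈ range (n + 1), ((m : ℝ) + 1) * G (Pi.single i ((d * m : ℕ) : ℤ)) := by
  classical
  set φ : ℕ → ℝ := fun m => ((m : ℝ) + 1) * G (Pi.single i ((d * m : ℕ) : ℤ)) with hφ
  have hφ0 : ∀ m, 0 ≤ φ m := fun m => mul_nonneg (by positivity) (hG0 _)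
  -- pointwise: `k G(k e) ≤ d φ(k/d)`
  have hpt : ∀ k : ℕ, (k : ℝ) * G (Pi.single i (k : ℤ)) ≤ d * φ (k / d) := by
    intro k
    have hle : G (Pi.single i (k : ℤ)) ≤ G (Pi.single i ((d * (k / d) : ℕ) : ℤ)) :=
      axis_le_axis hmono (by positivity) (by exact_mod_cast Nat.mul_div_le k d)
    have hk : (k : ℝ) ≤ d * ((k / d : ℕ) + 1 : ℝ) := by
      have : k < d * (k / d + 1) := Nat.lt_mul_div_succ k (by omega)
      exact_mod_cast this.le
    calc (k : ℝ) * G (Pi.single i (k : ℤ)) ≤ (k : ℝ) * G (Pi.single i ((d * (k / d) : ℕ) : ℤ)) :=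
          mul_le_mul_of_nonneg_left hle (Nat.cast_nonneg k)
      _ ≤ (d * ((k / d : ℕ) + 1 : ℝ)) * G (Pi.single i ((d * (k / d) : ℕ) : ℤ)) :=
          mul_le_mul_of_nonneg_right hk (hG0 _)
      _ = d * φ (k / d) := by rw [hφ]; ring
  -- fibres of `k ↦ k / d` have at most `d` elements and values `≤ n`
  have hfib : ∑ k ∈ range (n + 1), φ (k / d) ≤ d * ∑ m ∈ range (n + 1), φ m := by
    rw [Finset.sum_comp]
    have hcard : ∀ m : ℕ, #((range (n + 1)).filter (fun k => k / d = m)) ≤ d := by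
      intro m
      calc #((range (n + 1)).filter (fun k => k / d = m)) ≤ #(Ico (d * m) (d * m + d)) := by
            refine card_le_card fun k hk => ?_
            have hk := (mem_filter.1 hk).2
            rw [mem_Ico]
            subst hk
            constructor
            · exact Nat.mul_div_le k d
            · have := Nat.lt_mul_div_succ k (b := d) (by omega)
              linarith
        _ = d := by rw [Nat.card_Ico]; omega
    have himg : (range (n + 1)).image (fun k => k / d) ⊆ range (n + 1) := by
      intro m hm
      obtain ⟨k, hk, rfl⟩ := mem_image.1 hm
      rw [mem_range] at hk ⊢
      exact lt_of_le_of_lt (Nat.div_le_self k d) hk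
    calc ∑ m ∈ (range (n + 1)).image (fun k => k / d), #((range (n + 1)).filter (fun k => k / d = m)) • φ m
        ≤ ∑ m ∈ (range (n + 1)).image (fun k => k / d), (d : ℝ) * φ m := by
          refine sum_le_sum fun m _ => ?_
          rw [nsmul_eq_mul]
          exact mul_le_mul_of_nonneg_right (by exact_mod_cast hcard m) (hφ0 m)
      _ ≤ ∑ m ∈ range (n + 1), (d : ℝ) * φ m :=
          sum_le_sum_of_subset_of_nonneg himg fun m _ _ => mul_nonneg (Nat.cast_nonneg d) (hφ0 m)
      _ = d * ∑ m ∈ range (n + 1), φ m := by rw [mul_sum]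
  calc ∑ k ∈ range (n + 1), (k : ℝ) * G (Pi.single i (k : ℤ))
      ≤ ∑ k ∈ range (n + 1), d * φ (k / d) := sum_le_sum fun k _ => hpt k
    _ = d * ∑ k ∈ range (n + 1), φ (k / d) := by rw [mul_sum]
    _ ≤ d * (d * ∑ m ∈ range (n + 1), φ m) := mul_le_mul_of_nonneg_left hfib (Nat.cast_nonneg d)
    _ = (d : ℝ) ^ 2 * ∑ m ∈ range (n + 1), φ m := by ring

/-- `∑_{m ≤ n} (m+1) Ã_m ≤ 1 + 2 ∑_{m ≤ n} m Ã_m` (`Ã_0 = G(0) ≤ 1`, `m + 1 ≤ 2m` for `m ≥ 1`).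
[folklore] -/
theorem coarse_le (hG1 : ∀ x, G x ≤ 1) (hG0 : ∀ x, 0 ≤ G x) (n : ℕ) :
    ∑ m ∈ range (n + 1), ((m : ℝ) + 1) * G (Pi.single i ((d * m : ℕ) : ℤ)) ≤
      1 + 2 * ∑ m ∈ range (n + 1), (m : ℝ) * G (Pi.single i ((d * m : ℕ) : ℤ)) := by
  have hterm : ∀ m ∈ range (n + 1), ((m : ℝ) + 1) * G (Pi.single i ((d * m : ℕ) : ℤ)) ≤
      (if m = 0 then 1 else 0) + 2 * ((m : ℝ) * G (Pi.single i ((d * m : ℕ) : ℤ))) := by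
    intro m _
    by_cases hm : m = 0
    · subst hm; simp [hG1]
    · rw [if_neg hm, zero_add]
      have hm1 : (1 : ℝ) ≤ m := by exact_mod_cast Nat.one_le_iff_ne_zero.2 hm
      nlinarith [hG0 (Pi.single i ((d * m : ℕ) : ℤ))]
  calc ∑ m ∈ range (n + 1), ((m : ℝ) + 1) * G (Pi.single i ((d * m : ℕ) : ℤ))
      ≤ ∑ m ∈ range (n + 1), ((if m = 0 then (1 : ℝ) else 0) + 2 * ((m : ℝ) * G (Pi.single i ((d * m : ℕ) : ℤ)))) :=
        sum_le_sum hterm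
    _ = 1 + 2 * ∑ m ∈ range (n + 1), (m : ℝ) * G (Pi.single i ((d * m : ℕ) : ℤ)) := by
        rw [sum_add_distrib, mul_sum, sum_ite_eq' (range (n + 1)) 0 (fun _ => (1 : ℝ)), if_pos (by simp)]

end Split

/-! ### Shell sums and the bubble -/

section Shells

variable {G : Site d → ℝ} {i : Fin d}

/-- **Shell lower bound**: `m^{d-1} Ã_m² ≤ ∑_{‖y‖_∞ = m} G(y)²` for `m ≥ 1`, where `Ã_m = G(dm e_i)`
is below `G` on the sphere of radius `m` (Messager–Miracle-Solé, Duminil-Copin 2019 eq. (4.10))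
and `#{‖y‖_∞ = m} ≥ m^{d-1}`. [cite: DuminilCopin2019, Exercise 37 (4), eq. (4.10), §4.3] -/
theorem pow_mul_sq_le_shell (hG0 : ∀ x, 0 ≤ G x)
    (hsph : ∀ y : Site d, G (Pi.single i ((d : ℤ) * Site.supNorm y)) ≤ G y)
    (hd : 1 ≤ d) {m : ℕ} (hm : 1 ≤ m) :
    (m : ℝ) ^ (d - 1) * G (Pi.single i ((d * m : ℕ) : ℤ)) ^ 2 ≤ ∑ y ∈ sphere d m, G y ^ 2 := by
  obtain ⟨d', rfl⟩ : ∃ d', d = d' + 1 := ⟨d - 1, by omega⟩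
  obtain ⟨k, rfl⟩ : ∃ k, m = k + 1 := ⟨m - 1, by omega⟩
  have hcard : ((k + 1 : ℕ) : ℝ) ^ d' ≤ #(sphere (d' + 1) (k + 1)) := by
    exact_mod_cast pow_le_card_sphere_succ d' k
  simp only [Nat.add_sub_cancel]
  calc ((k + 1 : ℕ) : ℝ) ^ d' * G (Pi.single i (((d' + 1) * (k + 1) : ℕ) : ℤ)) ^ 2
      ≤ #(sphere (d' + 1) (k + 1)) * G (Pi.single i (((d' + 1) * (k + 1) : ℕ) : ℤ)) ^ 2 :=
        mul_le_mul_of_nonneg_right hcard (sq_nonneg _)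
    _ = ∑ _y ∈ sphere (d' + 1) (k + 1), G (Pi.single i (((d' + 1) * (k + 1) : ℕ) : ℤ)) ^ 2 := by
        rw [sum_const, nsmul_eq_mul]
    _ ≤ ∑ y ∈ sphere (d' + 1) (k + 1), G y ^ 2 := by
        refine sum_le_sum fun y hy => ?_
        have hyn : Site.supNorm y = k + 1 := mem_sphere.1 hy
        have h := hsph y
        rw [hyn] at h
        push_cast at h ⊢
        exact pow_le_pow_left₀ (hG0 _) h 2

/-- Box sums of `G²` are below the bubble `S₂ = Σ_x G(x)²`. [folklore] -/
theorem sum_box_sq_le_tsum (hsum : Summable fun x => G x ^ 2) (n : ℕ) :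
    ∑ y ∈ box d n, G y ^ 2 ≤ ∑' x, G x ^ 2 :=
  hsum.sum_le_tsum (box d n) fun x _ => sq_nonneg (G x)

/-- Shell sums up to radius `n` are below the bubble. [folklore] -/
theorem sum_range_shell_le_tsum (hsum : Summable fun x => G x ^ 2) (n : ℕ) :
    ∑ m ∈ range (n + 1), ∑ y ∈ sphere d m, G y ^ 2 ≤ ∑' x, G x ^ 2 := by
  rw [← SAWBubble.sum_box_eq_sum_range_sum_sphere n fun x => G x ^ 2]
  exact sum_box_sq_le_tsum hsum n

/-- **Weighted axis sum against the bubble**: `∑_{1 ≤ m ≤ n} m^{d-1} Ã_m² ≤ S₂`. [folklore] -/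
theorem sum_pow_mul_sq_le_tsum (hG0 : ∀ x, 0 ≤ G x)
    (hsph : ∀ y : Site d, G (Pi.single i ((d : ℤ) * Site.supNorm y)) ≤ G y)
    (hsum : Summable fun x => G x ^ 2) (hd : 1 ≤ d) (n : ℕ) :
    ∑ m ∈ range (n + 1), (if m = 0 then 0 else (m : ℝ) ^ (d - 1) * G (Pi.single i ((d * m : ℕ) : ℤ)) ^ 2) ≤
      ∑' x, G x ^ 2 := by
  refine le_trans (sum_le_sum fun m _ => ?_) (sum_range_shell_le_tsum hsum n)
  split_ifs with hm
  · exact sum_nonneg fun y _ => sq_nonneg _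
  · exact pow_mul_sq_le_shell hG0 hsph hd (Nat.one_le_iff_ne_zero.2 hm)

end Shells

/-! ### The first half is small: tail of the bubble -/

section FirstHalfSmall

variable {G : Site d → ℝ} {i : Fin d}

/-- A sub-box of the shell `Λ_{2M} ∖ Λ_M`: sites with `M < y_i ≤ 2M` and `|y_j| ≤ 2M`; it has
`M (4M+1)^{d-1}` elements. [folklore] -/
theorem card_slab (i : Fin d) (M : ℕ) :
    #(Fintype.piFinset fun j : Fin d => if j = i then Ioc (M : ℤ) (2 * M) else Icc (-(2 * M : ℤ)) (2 * M)) =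
      M * (4 * M + 1) ^ (d - 1) := by
  classical
  rw [Fintype.card_piFinset]
  have hf : ∀ j : Fin d, #(if j = i then Ioc (M : ℤ) (2 * M) else Icc (-(2 * M : ℤ)) (2 * M)) =
      if j = i then M else 4 * M + 1 := fun j => by
    split_ifs
    · rw [Int.card_Ioc]; omega
    · rw [Int.card_Icc]; omega
  simp_rw [hf]
  rw [Finset.prod_ite, prod_const, prod_const]
  have hc1 : #(univ.filter fun j : Fin d => j = i) = 1 := by
    rw [Finset.filter_eq', if_pos (mem_univ i), card_singleton]
  have hc2 : #(univ.filter fun j : Fin d => ¬ j = i) = d - 1 := by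
    have := Finset.card_filter_add_card_filter_not (s := (univ : Finset (Fin d))) (fun j : Fin d => j = i)
    rw [hc1, card_univ, Fintype.card_fin] at this
    omega
  rw [hc1, hc2, pow_one]

/-- **The first half tends to zero** (DCP 2025, (1.14): "Since `B(β_c) < ∞`, the sum on the
left-hand side of (1.14) tends to `0` as `n` tends to infinity"): for every `ε > 0`, for all large
`n`, `2d G((n-2)e_i) ∑_{x ∈ Λ_n} G(x) ≤ ε`. Proof: Cauchy–Schwarz bounds the box sum by
`√((2n+1)^d S₂)`, while `G((n-2)e_i)²` times the cardinality `M(4M+1)^{d-1}` of a slab inside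
`Λ_{2M} ∖ Λ_M`, `M = ⌊(n-2)/2d⌋`, is below the tail of the bubble beyond `Λ_M` (monotonicity:
`G((n-2)e_i) ≤ G(d‖y‖_∞ e_i) ≤ G(y)` there). [cite: DuminilCopinPanis2025LowerBounds, proof of Theorem 1.8, eq. (1.14)] -/
theorem firstHalf_small (hG0 : ∀ x, 0 ≤ G x)
    (hmono : ∀ x : Site d, 0 ≤ x i → G (x + Pi.single i 1) ≤ G x)
    (hsph : ∀ y : Site d, G (Pi.single i ((d : ℤ) * Site.supNorm y)) ≤ G y)
    (hsum : Summable fun x => G x ^ 2) (hd : 1 ≤ d) {ε : ℝ} (hε : 0 < ε) :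
    ∃ N₁ : ℕ, ∀ n : ℕ, N₁ ≤ n →
      2 * d * G (Pi.single i ((n : ℤ) - 2)) * ∑ x ∈ box d n, G x ≤ ε := by
  classical
  set D : ℕ := 2 * d with hD
  have hD2 : 2 ≤ D := by omega
  set S₂ : ℝ := ∑' x, G x ^ 2 with hS₂
  have hS₂0 : 0 ≤ S₂ := tsum_nonneg fun x => sq_nonneg _
  set K : ℝ := 4 * (d : ℝ) ^ 2 * (5 * D : ℝ) ^ d * (S₂ + 1) with hK
  have hK0 : 0 < K := by positivity
  set δ : ℝ := ε ^ 2 / K with hδ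
  have hδ0 : 0 < δ := by positivity
  -- vanishing of the tail
  obtain ⟨s, hs⟩ := summable_iff_vanishing.1 hsum (Set.Iio δ) (Iio_mem_nhds hδ0)
  obtain ⟨M₀, hM₀⟩ : ∃ M₀ : ℕ, s ⊆ box d M₀ :=
    ⟨s.sup Site.supNorm, fun x hx => mem_box_iff_supNorm_le.2 (Finset.le_sup hx)⟩
  refine ⟨M₀ * D + 3 * D + 2, fun n hn => ?_⟩
  set M : ℕ := (n - 2) / D with hM
  have hMM₀ : M₀ ≤ M := by
    rw [hM, Nat.le_div_iff_mul_le (by omega)]; omega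
  have hM3 : 3 ≤ M := by rw [hM, Nat.le_div_iff_mul_le (by omega)]; omega
  have hdM : M * D ≤ n - 2 := by rw [hM]; exact Nat.div_mul_le_self (n - 2) D
  have hlt : n - 2 < M * D + D := by rw [hM]; exact Nat.lt_div_mul_add (by omega)
  have h3D : 3 * D ≤ M * D := Nat.mul_le_mul_right D hM3
  -- `2n + 1 ≤ 5 M D`
  have hnM : 2 * n + 1 ≤ 5 * (M * D) := by omega
  -- the slab
  set T : Finset (Site d) :=
    Fintype.piFinset fun j : Fin d => if j = i then Ioc (M : ℤ) (2 * M) else Icc (-(2 * M : ℤ)) (2 * M) with hT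
  have hTmem : ∀ y ∈ T, (M : ℤ) < y i ∧ ∀ j, -(2 * M : ℤ) ≤ y j ∧ y j ≤ 2 * M := by
    intro y hy
    rw [hT, Fintype.mem_piFinset] at hy
    refine ⟨?_, fun j => ?_⟩
    · have := hy i; rw [if_pos rfl, mem_Ioc] at this; exact this.1
    · have := hy j
      by_cases hj : j = i
      · subst hj; rw [if_pos rfl, mem_Ioc] at this; omega
      · rw [if_neg hj, mem_Icc] at this; exact this
  have hTdisj : Disjoint T s := by
    rw [Finset.disjoint_left]
    intro y hyT hys
    have hyb := (mem_box.1 (hM₀ hys)) i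
    have := (hTmem y hyT).1
    omega
  have htail : ∑ y ∈ T, G y ^ 2 < δ := hs T hTdisj
  -- on the slab, `G((n-2)e) ≤ G(y)`
  set A : ℝ := G (Pi.single i ((n : ℤ) - 2)) with hA
  have hA0 : 0 ≤ A := hG0 _
  have hAle : ∀ y ∈ T, A ≤ G y := by
    intro y hy
    have hy2M : Site.supNorm y ≤ 2 * M := by
      rw [Site.supNorm_le_iff]; intro j; have := (hTmem y hy).2 j; omega
    have hdy : d * Site.supNorm y ≤ n - 2 := by
      have h1 : d * Site.supNorm y ≤ d * (2 * M) := Nat.mul_le_mul_left d hy2M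
      have h2 : d * (2 * M) = M * D := by rw [hD]; ring
      omega
    calc A ≤ G (Pi.single i ((d : ℤ) * Site.supNorm y)) := by
          rw [hA]; refine axis_le_axis hmono (by positivity) ?_
          have : ((d * Site.supNorm y : ℕ) : ℤ) ≤ ((n - 2 : ℕ) : ℤ) := by exact_mod_cast hdy
          push_cast [Nat.cast_sub (show 2 ≤ n by omega)] at this
          exact this
      _ ≤ G y := hsph y
  -- hence `#T · A² ≤ δ`
  have hcardA : (M : ℝ) * (4 * M + 1 : ℝ) ^ (d - 1) * A ^ 2 ≤ δ := by
    have hcT : ((#T : ℕ) : ℝ) = (M : ℝ) * (4 * M + 1 : ℝ) ^ (d - 1) := by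
      rw [hT, card_slab]; push_cast; ring
    calc (M : ℝ) * (4 * M + 1 : ℝ) ^ (d - 1) * A ^ 2 = ∑ _y ∈ T, A ^ 2 := by
          rw [sum_const, nsmul_eq_mul, hcT]
      _ ≤ ∑ y ∈ T, G y ^ 2 := sum_le_sum fun y hy => pow_le_pow_left₀ hA0 (hAle y hy) 2
      _ ≤ δ := htail.le
  -- Cauchy–Schwarz for the box sum
  have hCS : (∑ x ∈ box d n, G x) ^ 2 ≤ (2 * n + 1 : ℝ) ^ d * S₂ := by
    have h := sum_mul_sq_le_sq_mul_sq (box d n) (fun _ => (1 : ℝ)) G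
    simp only [one_mul, one_pow, sum_const, nsmul_eq_mul, mul_one] at h
    rw [card_box] at h
    push_cast at h
    exact h.trans (mul_le_mul_of_nonneg_left (sum_box_sq_le_tsum hsum n) (by positivity))
  -- compare `(2n+1)^d` with the slab cardinality
  have hcomp : (2 * n + 1 : ℝ) ^ d ≤ (5 * D : ℝ) ^ d * ((M : ℝ) * (4 * M + 1 : ℝ) ^ (d - 1)) := by
    obtain ⟨d', hd'⟩ : ∃ d', d = d' + 1 := ⟨d - 1, by omega⟩
    have h1 : (2 * n + 1 : ℝ) ≤ 5 * D * M := by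
      have : ((2 * n + 1 : ℕ) : ℝ) ≤ ((5 * (M * D) : ℕ) : ℝ) := by exact_mod_cast hnM
      push_cast at this; linarith
    have hM4 : (M : ℝ) ≤ 4 * M + 1 := by linarith [(Nat.cast_nonneg M : (0 : ℝ) ≤ M)]
    have h0 : (0 : ℝ) ≤ 2 * n + 1 := by positivity
    rw [hd', Nat.add_sub_cancel]
    calc (2 * n + 1 : ℝ) ^ (d' + 1) ≤ (5 * D * M : ℝ) ^ (d' + 1) := pow_le_pow_left₀ h0 h1 _
      _ = (5 * D : ℝ) ^ (d' + 1) * ((M : ℝ) * (M : ℝ) ^ d') := by ring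
      _ ≤ (5 * D : ℝ) ^ (d' + 1) * ((M : ℝ) * (4 * M + 1 : ℝ) ^ d') := by
          gcongr
  -- assemble: `(2d A χ)² ≤ ε²`
  have hsq : (2 * d * A * ∑ x ∈ box d n, G x) ^ 2 ≤ ε ^ 2 := by
    calc (2 * d * A * ∑ x ∈ box d n, G x) ^ 2 = 4 * (d : ℝ) ^ 2 * A ^ 2 * (∑ x ∈ box d n, G x) ^ 2 := by ring
      _ ≤ 4 * (d : ℝ) ^ 2 * A ^ 2 * ((2 * n + 1 : ℝ) ^ d * S₂) := by gcongr
      _ ≤ 4 * (d : ℝ) ^ 2 * A ^ 2 * ((5 * D : ℝ) ^ d * ((M : ℝ) * (4 * M + 1 : ℝ) ^ (d - 1)) * S₂) := by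
          gcongr
      _ = 4 * (d : ℝ) ^ 2 * (5 * D : ℝ) ^ d * S₂ * ((M : ℝ) * (4 * M + 1 : ℝ) ^ (d - 1) * A ^ 2) := by ring
      _ ≤ 4 * (d : ℝ) ^ 2 * (5 * D : ℝ) ^ d * S₂ * δ := by gcongr
      _ ≤ K * δ := by
          refine mul_le_mul_of_nonneg_right ?_ hδ0.le
          rw [hK]; gcongr; linarith
      _ = ε ^ 2 := by rw [hδ]; field_simp
  have hnn : 0 ≤ 2 * d * A * ∑ x ∈ box d n, G x :=
    mul_nonneg (mul_nonneg (by positivity) hA0) (sum_nonneg fun x _ => hG0 x)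
  exact (pow_le_pow_iff_left₀ hnn hε.le two_ne_zero).1 hsq

end FirstHalfSmall

section PartTwo

variable {G : Site d → ℝ} {i : Fin d}

/-! ### The lower bound on the axis two-point function (DCP 2025, (1.15)–(1.18)) -/

/-- **The axis lower bound.** Let `d ≥ 2` and let `G ≥ 0`, `G ≤ 1`, be even, nonincreasing along
the axis `i` from nonnegative coordinates, below its axis value `G(d‖y‖_∞ e_i)` nowhere
(MMS), with a square-summable bubble, and satisfying (H2) the gradient estimate and (H1) the
reflected-current inequality with constant `c₀`. If `(∑_{m ≤ n} m G(dm e_i))² ≤ ψ(n) C` with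
`ψ ≥ 1`, then `G(⌊n/4⌋ e_i) ≥ c₁/(n^{d-2}√ψ(n))` for some `c₁ > 0` and all large `n`
(DCP 2025, (1.15) with (1.16)/(1.18): "Putting the two previous displayed equations together gives
`⟨τ₀τ_{(n/4)e₁}⟩_{β_c} ≥ c₂/(n^{d-2}√(log n))`"). [cite: DuminilCopinPanis2025LowerBounds, proof of Theorem 1.8, eqs. (1.15)–(1.18)] -/
theorem axis_lower_bound (hd : 2 ≤ d) (hG0 : ∀ x, 0 ≤ G x) (hG1 : ∀ x, G x ≤ 1)
    (hGev : ∀ x : Site d, G (-x) = G x)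
    (hmono : ∀ x : Site d, 0 ≤ x i → G (x + Pi.single i 1) ≤ G x)
    (hsph : ∀ y : Site d, G (Pi.single i ((d : ℤ) * Site.supNorm y)) ≤ G y)
    (hgrad : ∀ (x : Site d) (j : ℕ), (j : ℤ) ≤ x i →
      G x - G (x + Pi.single i 1) ≤ G (Pi.single i (j : ℤ)) / ((x i : ℝ) - j + 1))
    (hsum : Summable fun x => G x ^ 2)
    (hrefl : ∃ c₀ : ℝ, 0 < c₀ ∧ ∃ N₀ : ℕ, ∀ n : ℕ, N₀ ≤ n →
      c₀ ≤ ∑ x ∈ box d n, ∑ y ∈ (box d n).filter (fun y => (zdGraph d).Adj x y),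
        (G x - G (axisRefl i (2 * n) x)) * G (y - axisRefl i (2 * n) y))
    {ψ : ℕ → ℝ} (hψ1 : ∀ n, 1 ≤ ψ n) {Cu : ℝ}
    (hU : ∀ n, (∑ m ∈ range (n + 1), (m : ℝ) * G (Pi.single i ((d * m : ℕ) : ℤ))) ^ 2 ≤ ψ n * Cu) :
    ∃ c₁ : ℝ, 0 < c₁ ∧ ∃ N : ℕ, ∀ n : ℕ, N ≤ n →
      c₁ / ((n : ℝ) ^ (d - 2) * Real.sqrt (ψ n)) ≤ G (Pi.single i ((n / 4 : ℕ) : ℤ)) := by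
  obtain ⟨c₀, hc₀, N₀, hT⟩ := hrefl
  have hd1 : 1 ≤ d := by omega
  obtain ⟨N₁, hN₁⟩ := firstHalf_small hG0 hmono hsph hsum hd1 (half_pos hc₀)
  set L : ℝ := 1 + 2 * (d : ℝ) ^ 2 + 4 * (d : ℝ) ^ 2 * Real.sqrt Cu with hL
  have hL1 : 1 ≤ L := by
    have : 0 ≤ 2 * (d : ℝ) ^ 2 + 4 * (d : ℝ) ^ 2 * Real.sqrt Cu := by positivity
    linarith
  set K : ℝ := 16 * d * (3 : ℝ) ^ (d - 1) * L with hK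
  have hL0 : 0 < L := by linarith
  have hdpos : (0 : ℝ) < d := by exact_mod_cast hd1
  have hK0 : 0 < K :=
    mul_pos (mul_pos (mul_pos (by norm_num) hdpos) (pow_pos (by norm_num) _)) hL0
  refine ⟨c₀ / (2 * K), by positivity, max N₀ (max N₁ 2), fun n hn => ?_⟩
  have hnN₀ : N₀ ≤ n := le_trans (le_max_left _ _) hn
  have hnN₁ : N₁ ≤ n := le_trans ((le_max_left _ _).trans (le_max_right _ _)) hn
  have hn2 : 2 ≤ n := le_trans ((le_max_right _ _).trans (le_max_right _ _)) hn
  have hn0 : (0 : ℝ) < n := by exact_mod_cast (show 0 < n by omega)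
  set a4 : ℝ := G (Pi.single i ((n / 4 : ℕ) : ℤ)) with ha4
  have ha40 : 0 ≤ a4 := hG0 _
  have hψ0 : 0 < ψ n := lt_of_lt_of_le one_pos (hψ1 n)
  have hsψ1 : 1 ≤ Real.sqrt (ψ n) := by rw [← Real.sqrt_one]; exact Real.sqrt_le_sqrt (hψ1 n)
  -- the main inequality `c₀/2 ≤ K n^{d-2} √ψ(n) a4`
  have key : c₀ / 2 ≤ K * (n : ℝ) ^ (d - 2) * Real.sqrt (ψ n) * a4 := by
    have hsplit := Finset.sum_filter_add_sum_filter_not (box d n) (fun x : Site d => 2 * x i ≤ (n : ℤ))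
      (fun x => ∑ y ∈ (box d n).filter (fun y => (zdGraph d).Adj x y),
        (G x - G (axisRefl i (2 * n) x)) * G (y - axisRefl i (2 * n) y))
    have h1 := firstHalf_le hG0 hGev hmono hn2 (i := i)
    have h1' := hN₁ n hnN₁
    have h2 := secondHalf_le hG0 hGev hmono hgrad n (i := i)
    have hWt := tsum_shift_le hG1 hG0 hmono n (i := i)
    have hW := axisSum_le_coarse hG0 hmono hd1 n (i := i)
    have hV := coarse_le hG1 hG0 n (i := i) (d := d)
    have hUn : ∑ m ∈ range (n + 1), (m : ℝ) * G (Pi.single i ((d * m : ℕ) : ℤ)) ≤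
        Real.sqrt (ψ n) * Real.sqrt Cu := by
      rw [← Real.sqrt_mul hψ0.le]
      exact (le_abs_self _).trans (Real.abs_le_sqrt (hU n))
    -- bound the `t`-sum by `L √ψ`
    have hchain : ∑ t ∈ range (n + 1), (t : ℝ) * G (Pi.single i (2 * (t : ℤ) - 2)) ≤ L * Real.sqrt (ψ n) := by
      have hd0 : (0 : ℝ) ≤ (d : ℝ) ^ 2 := by positivity
      calc ∑ t ∈ range (n + 1), (t : ℝ) * G (Pi.single i (2 * (t : ℤ) - 2))
          ≤ 1 + 2 * ((d : ℝ) ^ 2 * (1 + 2 * (Real.sqrt (ψ n) * Real.sqrt Cu))) := by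
            nlinarith [hWt, hW, hV, hUn]
        _ = 1 + 2 * (d : ℝ) ^ 2 + 4 * (d : ℝ) ^ 2 * Real.sqrt Cu * Real.sqrt (ψ n) := by ring
        _ ≤ (1 + 2 * (d : ℝ) ^ 2) * Real.sqrt (ψ n) + 4 * (d : ℝ) ^ 2 * Real.sqrt Cu * Real.sqrt (ψ n) := by
            nlinarith [hsψ1, hd0]
        _ = L * Real.sqrt (ψ n) := by rw [hL]; ring
    -- `(2n+1)^{d-1} ≤ 3^{d-1} n^{d-2} n`
    have hpow : (2 * n + 1 : ℝ) ^ (d - 1) ≤ (3 : ℝ) ^ (d - 1) * ((n : ℝ) ^ (d - 2) * n) := by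
      obtain ⟨d', hd'⟩ : ∃ d', d = d' + 2 := ⟨d - 2, by omega⟩
      subst hd'
      simp only [Nat.add_sub_cancel, show d' + 2 - 1 = d' + 1 by omega]
      have h3 : (2 * n + 1 : ℝ) ≤ 3 * n := by
        have : (1 : ℝ) ≤ n := by exact_mod_cast (show 1 ≤ n by omega)
        linarith
      calc (2 * n + 1 : ℝ) ^ (d' + 1) ≤ (3 * n : ℝ) ^ (d' + 1) := pow_le_pow_left₀ (by positivity) h3 _
        _ = (3 : ℝ) ^ (d' + 1) * ((n : ℝ) ^ d' * n) := by ring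
    have hT2 : c₀ / 2 ≤ ∑ x ∈ (box d n).filter (fun x : Site d => ¬ 2 * x i ≤ (n : ℤ)),
        ∑ y ∈ (box d n).filter (fun y => (zdGraph d).Adj x y),
          (G x - G (axisRefl i (2 * n) x)) * G (y - axisRefl i (2 * n) y) := by
      have := hT n hnN₀
      rw [← hsplit] at this
      linarith
    calc c₀ / 2 ≤ 2 * d * (2 * n + 1 : ℝ) ^ (d - 1) * (8 / n * a4) *
          ∑ t ∈ range (n + 1), (t : ℝ) * G (Pi.single i (2 * (t : ℤ) - 2)) := hT2.trans h2
      _ ≤ 2 * d * ((3 : ℝ) ^ (d - 1) * ((n : ℝ) ^ (d - 2) * n)) * (8 / n * a4) * (L * Real.sqrt (ψ n)) := by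
          gcongr
          · exact sum_nonneg fun t _ => mul_nonneg (Nat.cast_nonneg t) (hG0 _)
      _ = K * (n : ℝ) ^ (d - 2) * Real.sqrt (ψ n) * a4 := by
          rw [hK]; field_simp; ring
  -- divide
  have hP : 0 < (n : ℝ) ^ (d - 2) * Real.sqrt (ψ n) := by positivity
  rw [div_le_iff₀ hP, div_le_iff₀ (by positivity : (0 : ℝ) < 2 * K)]
  calc c₀ ≤ 2 * (K * (n : ℝ) ^ (d - 2) * Real.sqrt (ψ n) * a4) := by linarith
    _ = a4 * ((n : ℝ) ^ (d - 2) * Real.sqrt (ψ n)) * (2 * K) := by ring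


/-! ### `d = 3`: `G(y) ≥ c ‖y‖^{-3/2}` is not square-summable -/

/-- **DCP 2025, Theorem 1.8, `d = 3`, for an abstract two-point function**: under the hypotheses
of `axis_lower_bound` in `d = 3`, the bubble `Σ_x G(x)²` diverges ("If `d = 3`, using
Cauchy–Schwarz … `⟨τ₀τ_{(n/4)e₁}⟩_{β_c} ≥ c₃/n^{3/2}`. This contradicts, once again, the
finiteness of the bubble diagram"): Cauchy–Schwarz with weight `ψ(n) = n + 1`, then the
`η`-criterion `tsum_ofReal_sq_eq_top_of_lowerPowerLaw` with `η = 1/2` (`2η ≤ 4 - d`).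
[cite: DuminilCopinPanis2025LowerBounds, Theorem 1.8 (d = 3), eqs. (1.17)–(1.18)] -/
theorem not_summable_sq_three {G : Site 3 → ℝ} {i : Fin 3} (hG0 : ∀ x, 0 ≤ G x)
    (hG1 : ∀ x, G x ≤ 1) (hGev : ∀ x : Site 3, G (-x) = G x)
    (hmono : ∀ x : Site 3, 0 ≤ x i → G (x + Pi.single i 1) ≤ G x)
    (hsph : ∀ y : Site 3, G (Pi.single i ((3 : ℤ) * Site.supNorm y)) ≤ G y)
    (hgrad : ∀ (x : Site 3) (j : ℕ), (j : ℤ) ≤ x i →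
      G x - G (x + Pi.single i 1) ≤ G (Pi.single i (j : ℤ)) / ((x i : ℝ) - j + 1))
    (hrefl : ∃ c₀ : ℝ, 0 < c₀ ∧ ∃ N₀ : ℕ, ∀ n : ℕ, N₀ ≤ n →
      c₀ ≤ ∑ x ∈ box 3 n, ∑ y ∈ (box 3 n).filter (fun y => (zdGraph 3).Adj x y),
        (G x - G (axisRefl i (2 * n) x)) * G (y - axisRefl i (2 * n) y)) :
    ¬ Summable fun x => G x ^ 2 := by
  intro hsum
  have hsph' : ∀ y : Site 3, G (Pi.single i (((3 : ℕ) : ℤ) * Site.supNorm y)) ≤ G y := fun y => by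
    exact_mod_cast hsph y
  -- Cauchy–Schwarz with weight `n + 1`
  have hU : ∀ n, (∑ m ∈ range (n + 1), (m : ℝ) * G (Pi.single i ((3 * m : ℕ) : ℤ))) ^ 2 ≤
      ((n : ℝ) + 1) * ∑' x, G x ^ 2 := by
    intro n
    have hcs := sum_mul_sq_le_sq_mul_sq (range (n + 1)) (fun _ => (1 : ℝ))
      (fun m => (m : ℝ) * G (Pi.single i ((3 * m : ℕ) : ℤ)))
    simp only [one_mul, one_pow, sum_const, card_range, nsmul_eq_mul, mul_one] at hcs
    rw [show ((n : ℝ) + 1) = ((n + 1 : ℕ) : ℝ) by norm_cast]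
    refine hcs.trans (mul_le_mul_of_nonneg_left ?_ (by positivity))
    refine le_trans (le_of_eq (sum_congr rfl fun m _ => ?_)) (sum_pow_mul_sq_le_tsum hG0 hsph' hsum (by norm_num) n)
    split_ifs with hm
    · subst hm; simp
    · rw [mul_pow]
  obtain ⟨c₁, hc₁, N, hN⟩ := axis_lower_bound (by norm_num) hG0 hG1 hGev hmono hsph' hgrad hsum hrefl
    (ψ := fun n => (n : ℝ) + 1) (fun n => by simp) hU
  -- the lower power law with `η = 1/2`
  have hlow : ∀ y : Site 3, max N 1 ≤ Site.supNorm y →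
      (c₁ / 48) / (Site.supNorm y : ℝ) ^ ((3 : ℝ) - 2 + 1 / 2) ≤ G y := by
    intro y hy
    set m : ℕ := Site.supNorm y with hm
    have hmN : N ≤ m := le_trans (le_max_left _ _) hy
    have hm1 : 1 ≤ m := le_trans (le_max_right _ _) hy
    have hm0 : (0 : ℝ) < m := by exact_mod_cast hm1
    have h := hN (12 * m) (by omega)
    rw [show 12 * m / 4 = 3 * m by omega] at h
    simp only [show (3 : ℕ) - 2 = 1 from rfl, pow_one] at h
    have hrpow : (m : ℝ) ^ ((3 : ℝ) - 2 + 1 / 2) = m * Real.sqrt m := by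
      rw [show (3 : ℝ) - 2 + 1 / 2 = 1 + 1 / 2 by norm_num, Real.rpow_add hm0, Real.rpow_one,
        Real.sqrt_eq_rpow]
    rw [hrpow]
    have hsq : Real.sqrt (((12 * m : ℕ) : ℝ) + 1) ≤ 4 * Real.sqrt m := by
      rw [show (4 : ℝ) = Real.sqrt 16 by rw [show (16 : ℝ) = 4 ^ 2 by norm_num, Real.sqrt_sq (by norm_num)],
        ← Real.sqrt_mul (by norm_num)]
      refine Real.sqrt_le_sqrt ?_
      push_cast; linarith [(show (1 : ℝ) ≤ m by exact_mod_cast hm1)]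
    have hsq0 : 0 < Real.sqrt (((12 * m : ℕ) : ℝ) + 1) := Real.sqrt_pos.2 (by positivity)
    calc c₁ / 48 / ((m : ℝ) * Real.sqrt m) = c₁ / (((12 * m : ℕ) : ℝ) * (4 * Real.sqrt m)) := by
          push_cast; field_simp; ring
      _ ≤ c₁ / (((12 * m : ℕ) : ℝ) * Real.sqrt (((12 * m : ℕ) : ℝ) + 1)) := by
          refine div_le_div_of_nonneg_left hc₁.le (by positivity) ?_
          exact mul_le_mul_of_nonneg_left hsq (by positivity)
      _ ≤ G (Pi.single i ((3 * m : ℕ) : ℤ)) := h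
      _ ≤ G y := by
          have := hsph' y
          rwa [← hm] at this
  have htop := tsum_ofReal_sq_eq_top_of_lowerPowerLaw (d := 3) (by norm_num) (η := 1 / 2) (by norm_num)
    (by positivity : (0 : ℝ) < c₁ / 48) hlow
  have hne : ∑' y : Site 3, ENNReal.ofReal (G y) ^ 2 ≠ ∞ := by
    have : ∑' y : Site 3, ENNReal.ofReal (G y) ^ 2 = ∑' y, ENNReal.ofReal (G y ^ 2) :=
      tsum_congr fun y => by rw [ENNReal.ofReal_pow (hG0 y)]
    rw [this, ← ENNReal.ofReal_tsum_of_nonneg (fun y => sq_nonneg _) hsum]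
    exact ENNReal.ofReal_ne_top
  exact hne htop

/-! ### `d = 4`: harmonic numbers and Cauchy condensation -/

/-- Harmonic numbers `H_N = ∑_{m<N} 1/(m+1)` are at least `1` for `N ≥ 1`. [folklore] -/
theorem one_le_harmonicSum {N : ℕ} (hN : 1 ≤ N) : (1 : ℝ) ≤ ∑ m ∈ range N, 1 / ((m : ℝ) + 1) := by
  calc (1 : ℝ) = 1 / (((0 : ℕ) : ℝ) + 1) := by norm_num
    _ ≤ ∑ m ∈ range N, 1 / ((m : ℝ) + 1) :=
        single_le_sum (f := fun m : ℕ => 1 / ((m : ℝ) + 1)) (fun m _ => by positivity) (mem_range.2 (by omega))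

/-- Harmonic numbers are monotone. [folklore] -/
theorem harmonicSum_mono {N N' : ℕ} (h : N ≤ N') :
    ∑ m ∈ range N, 1 / ((m : ℝ) + 1) ≤ ∑ m ∈ range N', 1 / ((m : ℝ) + 1) :=
  sum_le_sum_of_subset_of_nonneg (range_subset_range.2 h) fun m _ _ => by positivity

/-- Doubling: `H_{2N} ≤ H_N + 1`. [folklore] -/
theorem harmonicSum_two_mul_le (N : ℕ) :
    ∑ m ∈ range (2 * N), 1 / ((m : ℝ) + 1) ≤ ∑ m ∈ range N, 1 / ((m : ℝ) + 1) + 1 := by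
  rw [Finset.range_eq_Ico, ← Finset.sum_Ico_consecutive (fun m : ℕ => 1 / ((m : ℝ) + 1)) (Nat.zero_le N)
    (by omega : N ≤ 2 * N), ← Finset.range_eq_Ico]
  refine add_le_add le_rfl ?_
  calc ∑ m ∈ Ico N (2 * N), 1 / ((m : ℝ) + 1) ≤ ∑ _m ∈ Ico N (2 * N), 1 / ((N : ℝ) + 1) := by
        refine sum_le_sum fun m hm => ?_
        have : (N : ℝ) ≤ m := by exact_mod_cast (mem_Ico.1 hm).1
        exact one_div_le_one_div_of_le (by positivity) (by linarith)
    _ = N * (1 / ((N : ℝ) + 1)) := by rw [sum_const, Nat.card_Ico, show 2 * N - N = N by omega, nsmul_eq_mul]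
    _ ≤ 1 := by
        rw [mul_one_div, div_le_one (by positivity)]; linarith

/-- Dyadic bound `H_{2^j} ≤ j + 1`. [folklore] -/
theorem harmonicSum_two_pow_le (j : ℕ) : ∑ m ∈ range (2 ^ j), 1 / ((m : ℝ) + 1) ≤ j + 1 := by
  induction j with
  | zero => simp
  | succ j ih =>
      rw [pow_succ, mul_comm]
      refine (harmonicSum_two_mul_le (2 ^ j)).trans ?_
      push_cast; linarith

/-- `∑_n 1/(n H_{32 n})`-type series diverge: if `f ≥ 0` is antitone from `n = 1` on with
`c/(n · H_{16n+1}) ≤ f(n)` for `n ≥ 1`, `c > 0`, then `f` is not summable (Cauchy condensation: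
`2^k f(2^k) ≥ c/H_{2^{k+5}} ≥ c/(k+6)`, a harmonic tail). [folklore] -/
theorem not_summable_of_harmonic_lower {f : ℕ → ℝ} (hf0 : ∀ n, 0 ≤ f n)
    (hmono : ∀ ⦃m n : ℕ⦄, 0 < m → m ≤ n → f n ≤ f m) {c : ℝ} (hc : 0 < c)
    (hlow : ∀ n : ℕ, 1 ≤ n →
      c / ((n : ℝ) * ∑ m ∈ range (16 * n + 1), 1 / ((m : ℝ) + 1)) ≤ f n) :
    ¬ Summable f := by
  intro hs
  have hcond := (summable_condensed_iff_of_nonneg hf0 hmono).2 hs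
  -- `2^k f(2^k) ≥ c/(k+6)`
  have hk : ∀ k : ℕ, c / ((k : ℝ) + 6) ≤ (2 : ℝ) ^ k * f (2 ^ k) := by
    intro k
    have h2k : (1 : ℕ) ≤ 2 ^ k := Nat.one_le_two_pow
    have hH : ∑ m ∈ range (16 * 2 ^ k + 1), 1 / ((m : ℝ) + 1) ≤ (k : ℝ) + 6 := by
      calc ∑ m ∈ range (16 * 2 ^ k + 1), 1 / ((m : ℝ) + 1)
          ≤ ∑ m ∈ range (2 ^ (k + 5)), 1 / ((m : ℝ) + 1) := harmonicSum_mono (by rw [pow_add]; norm_num; omega)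
        _ ≤ (k + 5 : ℕ) + 1 := harmonicSum_two_pow_le (k + 5)
        _ = (k : ℝ) + 6 := by push_cast; ring
    have hH0 : 0 < ∑ m ∈ range (16 * 2 ^ k + 1), 1 / ((m : ℝ) + 1) :=
      lt_of_lt_of_le one_pos (one_le_harmonicSum (by omega))
    have h := hlow (2 ^ k) h2k
    have hpow : ((2 ^ k : ℕ) : ℝ) = (2 : ℝ) ^ k := by push_cast; ring
    rw [hpow] at h
    calc c / ((k : ℝ) + 6) ≤ c / ∑ m ∈ range (16 * 2 ^ k + 1), 1 / ((m : ℝ) + 1) :=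
          div_le_div_of_nonneg_left hc.le hH0 hH
      _ = (2 : ℝ) ^ k * (c / ((2 : ℝ) ^ k * ∑ m ∈ range (16 * 2 ^ k + 1), 1 / ((m : ℝ) + 1))) := by
          field_simp
      _ ≤ (2 : ℝ) ^ k * f (2 ^ k) := mul_le_mul_of_nonneg_left h (by positivity)
  have hsum6 : Summable fun k : ℕ => c / ((k : ℝ) + 6) :=
    Summable.of_nonneg_of_le (fun k => by positivity) hk hcond
  have hsum1 : Summable fun k : ℕ => 1 / ((k : ℝ) + 6) := by
    have := hsum6.mul_left (1 / c)
    refine this.congr fun k => ?_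
    field_simp
  have : Summable fun n : ℕ => 1 / (n : ℝ) := by
    rw [← summable_nat_add_iff 6]
    refine hsum1.congr fun k => ?_
    push_cast; ring
  exact Real.not_summable_one_div_natCast this

/-- **DCP 2025, Theorem 1.8, `d = 4`, for an abstract two-point function**: under the hypotheses
of `axis_lower_bound` in `d = 4`, `Σ_x G(x)² = ∞` ("Assume first that `d = 4`. Using
Cauchy–Schwarz … `⟨τ₀τ_{(n/4)e₁}⟩_{β_c} ≥ c₂/(n^{d-2}√(log n))` … We find that `B(β_c) = ∞`,
which is a contradiction"): Cauchy–Schwarz with the harmonic weight `ψ(n) = H_{n+1}`, shell sums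
`∑_{‖y‖=m} G² ≥ c/(m H_{16m+1})`, and `not_summable_of_harmonic_lower`.
[cite: DuminilCopinPanis2025LowerBounds, Theorem 1.8 (d = 4), eqs. (1.15)–(1.16)] -/
theorem not_summable_sq_four {G : Site 4 → ℝ} {i : Fin 4} (hG0 : ∀ x, 0 ≤ G x)
    (hG1 : ∀ x, G x ≤ 1) (hGev : ∀ x : Site 4, G (-x) = G x)
    (hmono : ∀ x : Site 4, 0 ≤ x i → G (x + Pi.single i 1) ≤ G x)
    (hsph : ∀ y : Site 4, G (Pi.single i ((4 : ℤ) * Site.supNorm y)) ≤ G y)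
    (hgrad : ∀ (x : Site 4) (j : ℕ), (j : ℤ) ≤ x i →
      G x - G (x + Pi.single i 1) ≤ G (Pi.single i (j : ℤ)) / ((x i : ℝ) - j + 1))
    (hrefl : ∃ c₀ : ℝ, 0 < c₀ ∧ ∃ N₀ : ℕ, ∀ n : ℕ, N₀ ≤ n →
      c₀ ≤ ∑ x ∈ box 4 n, ∑ y ∈ (box 4 n).filter (fun y => (zdGraph 4).Adj x y),
        (G x - G (axisRefl i (2 * n) x)) * G (y - axisRefl i (2 * n) y)) :
    ¬ Summable fun x => G x ^ 2 := by
  intro hsum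
  have hsph' : ∀ y : Site 4, G (Pi.single i (((4 : ℕ) : ℤ) * Site.supNorm y)) ≤ G y := fun y => by
    exact_mod_cast hsph y
  set S₂ : ℝ := ∑' x, G x ^ 2 with hS₂
  set H : ℕ → ℝ := fun N => ∑ m ∈ range N, 1 / ((m : ℝ) + 1) with hH
  -- Cauchy–Schwarz with the harmonic weight
  have hU : ∀ n, (∑ m ∈ range (n + 1), (m : ℝ) * G (Pi.single i ((4 * m : ℕ) : ℤ))) ^ 2 ≤
      H (n + 1) * (2 * S₂) := by
    intro n
    have hcs := sum_sq_le_sum_mul_sum_of_sq_le_mul (range (n + 1))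
      (r := fun m => (m : ℝ) * G (Pi.single i ((4 * m : ℕ) : ℤ)))
      (f := fun m => 1 / ((m : ℝ) + 1))
      (g := fun m => ((m : ℝ) + 1) * (m : ℝ) ^ 2 * G (Pi.single i ((4 * m : ℕ) : ℤ)) ^ 2)
      (fun m _ => by positivity) (fun m _ => by positivity)
      (fun m _ => by field_simp; ring_nf; exact le_rfl)
    refine hcs.trans (mul_le_mul_of_nonneg_left ?_ (sum_nonneg fun m _ => by positivity))
    have h2 := sum_pow_mul_sq_le_tsum hG0 hsph' hsum (by norm_num) n
    simp only [show (4 : ℕ) - 1 = 3 from rfl] at h2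
    calc ∑ m ∈ range (n + 1), ((m : ℝ) + 1) * (m : ℝ) ^ 2 * G (Pi.single i ((4 * m : ℕ) : ℤ)) ^ 2
        ≤ ∑ m ∈ range (n + 1), 2 * (if m = 0 then 0 else (m : ℝ) ^ 3 * G (Pi.single i ((4 * m : ℕ) : ℤ)) ^ 2) := by
          refine sum_le_sum fun m _ => ?_
          split_ifs with hm
          · subst hm; simp
          · have hm1 : (1 : ℝ) ≤ m := by exact_mod_cast Nat.one_le_iff_ne_zero.2 hm
            have hg : 0 ≤ G (Pi.single i ((4 * m : ℕ) : ℤ)) ^ 2 := sq_nonneg _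
            nlinarith [mul_nonneg (mul_nonneg (by positivity : (0 : ℝ) ≤ (m : ℝ) ^ 2) (sub_nonneg.2 hm1)) hg]
      _ = 2 * ∑ m ∈ range (n + 1), (if m = 0 then 0 else (m : ℝ) ^ 3 * G (Pi.single i ((4 * m : ℕ) : ℤ)) ^ 2) := by
          rw [mul_sum]
      _ ≤ 2 * S₂ := by linarith
  obtain ⟨c₁, hc₁, N, hN⟩ := axis_lower_bound (by norm_num) hG0 hG1 hGev hmono hsph' hgrad hsum hrefl
    (ψ := fun n => H (n + 1)) (fun n => one_le_harmonicSum (by omega)) hU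
  simp only [show (4 : ℕ) - 2 = 2 from rfl] at hN
  -- shell sums
  set F : ℕ → ℝ := fun m => ∑ y ∈ sphere 4 m, G y ^ 2 with hF
  have hF0 : ∀ m, 0 ≤ F m := fun m => sum_nonneg fun y _ => sq_nonneg _
  have hFsum : Summable F := by
    refine summable_of_sum_range_le hF0 (c := S₂) fun n => ?_
    calc ∑ m ∈ range n, F m ≤ ∑ m ∈ range (n + 1), F m :=
          sum_le_sum_of_subset_of_nonneg (range_subset_range.2 (Nat.le_succ n)) fun m _ _ => hF0 m
      _ ≤ S₂ := sum_range_shell_le_tsum hsum n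
  -- the comparison sequence
  set c : ℝ := c₁ ^ 2 / 65536 with hc
  have hc0 : 0 < c := by positivity
  set f : ℕ → ℝ := fun m => if m < max N 1 then F m else c / ((m : ℝ) * H (16 * m + 1)) with hf
  have hHpos : ∀ m : ℕ, 0 < H (16 * m + 1) := fun m => lt_of_lt_of_le one_pos (one_le_harmonicSum (by omega))
  have hf0 : ∀ m, 0 ≤ f m := fun m => by
    rw [hf]; simp only; split_ifs
    · exact hF0 m
    · exact div_nonneg hc0.le (mul_nonneg (Nat.cast_nonneg m) (hHpos m).le)
  -- `f ≤ F` from `max N 1` on: the shell lower bound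
  have hfF : ∀ m, f m ≤ F m := by
    intro m
    rw [hf]; simp only
    split_ifs with hm
    · exact le_rfl
    · push Not at hm
      have hmN : N ≤ m := le_trans (le_max_left _ _) hm
      have hm1 : 1 ≤ m := le_trans (le_max_right _ _) hm
      have hm0 : (0 : ℝ) < m := by exact_mod_cast hm1
      have h := hN (16 * m) (by omega)
      rw [show 16 * m / 4 = 4 * m by omega] at h
      -- `Ã_m² ≥ c₁²/((16m)⁴ H(16m+1))`
      have hpos : 0 < (((16 * m : ℕ) : ℝ)) ^ 2 * Real.sqrt (H (16 * m + 1)) := by positivity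
      have hA : c₁ / ((((16 * m : ℕ) : ℝ)) ^ 2 * Real.sqrt (H (16 * m + 1))) ≤ G (Pi.single i ((4 * m : ℕ) : ℤ)) := h
      have hA2 : c₁ ^ 2 / ((((16 * m : ℕ) : ℝ)) ^ 4 * H (16 * m + 1)) ≤ G (Pi.single i ((4 * m : ℕ) : ℤ)) ^ 2 := by
        have h0 : 0 ≤ c₁ / ((((16 * m : ℕ) : ℝ)) ^ 2 * Real.sqrt (H (16 * m + 1))) := by positivity
        have := pow_le_pow_left₀ h0 hA 2
        rw [div_pow, mul_pow, Real.sq_sqrt (hHpos m).le, ← pow_mul] at this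
        exact this
      have hshell := pow_mul_sq_le_shell hG0 hsph' (by norm_num) hm1 (i := i)
      simp only [show (4 : ℕ) - 1 = 3 from rfl] at hshell
      calc c / ((m : ℝ) * H (16 * m + 1)) = (m : ℝ) ^ 3 * (c₁ ^ 2 / ((((16 * m : ℕ) : ℝ)) ^ 4 * H (16 * m + 1))) := by
            rw [hc]; push_cast; field_simp; ring
        _ ≤ (m : ℝ) ^ 3 * G (Pi.single i ((4 * m : ℕ) : ℤ)) ^ 2 := mul_le_mul_of_nonneg_left hA2 (by positivity)
        _ ≤ F m := hshell
  have hfsum : Summable f := Summable.of_nonneg_of_le hf0 hfF hFsum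
  -- `f` is antitone from `1` on? only beyond `max N 1`; shift to apply condensation
  set M₁ : ℕ := max N 1 with hM₁
  set g : ℕ → ℝ := fun m => c / (((m + M₁ : ℕ) : ℝ) * H (16 * (m + M₁) + 1)) with hg
  have hgf : ∀ m, g m = f (m + M₁) := fun m => by
    rw [hg, hf]; simp only; rw [if_neg (by omega)]
  have hgsum : Summable g := by
    have := (summable_nat_add_iff M₁).2 hfsum
    exact this.congr fun m => (hgf m).symm
  -- `g` dominates `m ↦ c/((m+M₁) H(16(m+M₁)+1))`, antitone; compare with `c' /(n H(16 n + 1))` at `n = m + M₁`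
  -- apply the harmonic non-summability to `n ↦ g (n - M₁)`-type sequence: use `h n := c/((n + M₁) H(16(n+M₁)+1))` directly
  have hg0 : ∀ m, 0 ≤ g m := fun m => by rw [hgf]; exact hf0 _
  have hgmono : ∀ ⦃m n : ℕ⦄, 0 < m → m ≤ n → g n ≤ g m := by
    intro m n _ hmn
    rw [hg]; simp only
    refine div_le_div_of_nonneg_left hc0.le (mul_pos (by positivity) (hHpos _)) ?_
    refine mul_le_mul (by exact_mod_cast (by omega : m + M₁ ≤ n + M₁)) (harmonicSum_mono (by omega))
      (hHpos _).le (by positivity)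
  -- lower bound `c/(2 M₁) / (n H(16 n + 1)) ≤ g n` for `n ≥ 1`: since `n + M₁ ≤ 2 M₁ n` and `H(16(n+M₁)+1) ≤ H(16 · 2M₁ n + 1) ≤ ...`
  -- simpler: compare `g` with `n ↦ c / ((2 M₁ n) H(16 (2 M₁ n) + 1))` and use monotonicity in the argument.
  have hM₁1 : 1 ≤ M₁ := le_max_right _ _
  -- `H(kN) ≤ k H(N)` (later blocks have smaller terms)
  have hsub : ∀ k L : ℕ, H (k * L) ≤ k * H L := by
    intro k L
    induction k with
    | zero => simp [hH]
    | succ k ih =>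
        have hsplit : H ((k + 1) * L) = H (k * L) + ∑ m ∈ Ico (k * L) (k * L + L), 1 / ((m : ℝ) + 1) := by
          rw [hH]; simp only
          rw [Nat.succ_mul, Finset.range_eq_Ico, Finset.range_eq_Ico,
            Finset.sum_Ico_consecutive (fun m : ℕ => 1 / ((m : ℝ) + 1)) (Nat.zero_le (k * L))
              (Nat.le_add_right (k * L) L)]
        have htail : ∑ m ∈ Ico (k * L) (k * L + L), 1 / ((m : ℝ) + 1) ≤ H L := by
          have hre : ∑ m ∈ Ico (k * L) (k * L + L), 1 / ((m : ℝ) + 1) =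
              ∑ m ∈ Ico 0 L, 1 / (((m + k * L : ℕ) : ℝ) + 1) := by
            rw [Finset.sum_Ico_add' (fun m : ℕ => 1 / ((m : ℝ) + 1)) 0 L (k * L), zero_add, add_comm L (k * L)]
          rw [hre, hH]; simp only; rw [Finset.range_eq_Ico]
          refine sum_le_sum fun m _ => ?_
          have hkL : (0 : ℝ) ≤ (k : ℝ) * L := by positivity
          exact one_div_le_one_div_of_le (by positivity) (by push_cast; linarith)
        rw [hsplit]; push_cast; linarith
  have hlow : ∀ n : ℕ, 1 ≤ n →
      (c / (4 * (M₁ : ℝ) ^ 2)) / ((n : ℝ) * ∑ m ∈ range (16 * n + 1), 1 / ((m : ℝ) + 1)) ≤ g n := by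
    intro n hn
    rw [hg]; simp only
    have hle1 : ((n + M₁ : ℕ) : ℝ) ≤ 2 * M₁ * n := by
      have : n + M₁ ≤ 2 * M₁ * n := by nlinarith
      exact_mod_cast this
    have hHn : H (16 * n + 1) = ∑ m ∈ range (16 * n + 1), 1 / ((m : ℝ) + 1) := rfl
    have hH1 : H (16 * (n + M₁) + 1) ≤ (2 * M₁ : ℝ) * H (16 * n + 1) := by
      calc H (16 * (n + M₁) + 1) ≤ H ((2 * M₁) * (16 * n + 1)) := harmonicSum_mono (by nlinarith)
        _ ≤ ((2 * M₁ : ℕ) : ℝ) * H (16 * n + 1) := hsub (2 * M₁) (16 * n + 1)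
        _ = (2 * M₁ : ℝ) * H (16 * n + 1) := by push_cast; ring
    have hHn0 : 0 < H (16 * n + 1) := hHpos n
    have hn0 : (0 : ℝ) < n := by exact_mod_cast hn
    have hM₁0 : (0 : ℝ) < M₁ := by exact_mod_cast hM₁1
    have hD : ((n + M₁ : ℕ) : ℝ) * H (16 * (n + M₁) + 1) ≤ 4 * (M₁ : ℝ) ^ 2 * ((n : ℝ) * H (16 * n + 1)) := by
      calc ((n + M₁ : ℕ) : ℝ) * H (16 * (n + M₁) + 1) ≤ (2 * M₁ * n) * ((2 * M₁ : ℝ) * H (16 * n + 1)) :=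
            mul_le_mul hle1 hH1 (hHpos _).le (by positivity)
        _ = 4 * (M₁ : ℝ) ^ 2 * ((n : ℝ) * H (16 * n + 1)) := by ring
    rw [← hHn]
    calc c / (4 * (M₁ : ℝ) ^ 2) / ((n : ℝ) * H (16 * n + 1)) = c / (4 * (M₁ : ℝ) ^ 2 * ((n : ℝ) * H (16 * n + 1))) := by
          rw [div_div]
      _ ≤ c / (((n + M₁ : ℕ) : ℝ) * H (16 * (n + M₁) + 1)) :=
          div_le_div_of_nonneg_left hc0.le (mul_pos (by positivity) (hHpos _)) hD
  exact not_summable_of_harmonic_lower hg0 hgmono (by positivity : 0 < c / (4 * (M₁ : ℝ) ^ 2)) hlow hgsum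

end PartTwo

end DCPBubble

/-! ### The nearest-neighbour Ising model on `ℤ³` and `ℤ⁴` -/

namespace NNIsing

variable {d : ℕ}

/-- **Duminil-Copin–Panis 2025, Theorem 1.8, from Theorem 1.2 and the gradient estimate.** For the
nearest-neighbour Ising model on `ℤ^d`, `d ∈ {3, 4}`, at the tree's `criticalBeta d`, write
`G(x) = ⟨σ₀σ_x⟩^f_{β_c}` (`twoPointFree`). If `G` satisfies, along some axis `i`, (H2) the gradient
estimate `G(x) - G(x + e_i) ≤ G(j e_i)/(x_i - j + 1)` (`0 ≤ j ≤ x_i`; the source's (1.11), from the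
spectral representation) and (H1) the reflected-current inequality of Theorem 1.2 at `β_c`
(`c₀ ≤ ∑_{x, y ∈ Λ_n, y ∼ x} (G(x) - G(R_n x)) G(y - R_n y)` for all large `n`; the factor `β_c`
of the source is absorbed in `c₀`, and `n ≤ L(β_c) = ∞` is automatic), then the bubble condition
FAILS: `B(β_c) = Σ_x ⟨σ₀σ_x⟩²_{β_c} = ∞`, i.e. `¬ NNIsing.BubbleCondition d`. The Messager–Miracle-Solé
inputs of the printed proof are the tree's theorems `messager_miracleSole_free`,
`twoPointFree_diagAxis_le_of_mem_sphere'`, `twoPointFree_abs_eq`, `twoPointFree_single_eq_single`;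
`0 ≤ G ≤ 1` by GKS. [cite: DuminilCopinPanis2025LowerBounds, Theorem 1.8 with Theorems 1.2–1.3] -/
theorem not_bubbleCondition_of_dcp (hd : d = 3 ∨ d = 4) (i : Fin d)
    (hgrad : ∀ (x : Site d) (j : ℕ), (j : ℤ) ≤ x i →
      twoPointFree d (criticalBeta d) x - twoPointFree d (criticalBeta d) (x + Pi.single i 1) ≤
        twoPointFree d (criticalBeta d) (Pi.single i (j : ℤ)) / ((x i : ℝ) - j + 1))
    (hrefl : ∃ c₀ : ℝ, 0 < c₀ ∧ ∃ N₀ : ℕ, ∀ n : ℕ, N₀ ≤ n →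
      c₀ ≤ ∑ x ∈ box d n, ∑ y ∈ (box d n).filter (fun y => (zdGraph d).Adj x y),
        (twoPointFree d (criticalBeta d) x - twoPointFree d (criticalBeta d) (axisRefl i (2 * n) x)) *
          twoPointFree d (criticalBeta d) (y - axisRefl i (2 * n) y)) :
    ¬ BubbleCondition d := by
  intro hB
  rw [BubbleCondition, bubbleDiagram] at hB
  have hβ : 0 ≤ criticalBeta d := criticalBeta_nonneg d
  set β : ℝ := criticalBeta d with hβdef
  set G : Site d → ℝ := twoPointFree d β with hG
  have hd1 : 1 ≤ d := by omega
  have hG0 : ∀ x, 0 ≤ G x := fun x =>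
    twoPointFree_nonneg hasBoxLimit_isingCorr_free_holds (GKSInequalities.gks_one_holds (zdGraph d)) hβ x
  have hG1 : ∀ x, G x ≤ 1 := fun x => twoPointFree_le_one hasBoxLimit_isingCorr_free_holds hβ x
  have hGev : ∀ x : Site d, G (-x) = G x := fun x => by
    simp only [hG]
    rw [← twoPointFree_abs_eq hβ (-x), ← twoPointFree_abs_eq hβ x]
    simp [abs_neg]
  have hmono : ∀ x : Site d, 0 ≤ x i → G (x + Pi.single i 1) ≤ G x := fun x hx =>
    messager_miracleSole_free hβ x i hx
  have hsph : ∀ y : Site d, G (Pi.single i ((d : ℤ) * Site.supNorm y)) ≤ G y := fun y => by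
    simp only [hG]
    rw [← twoPointFree_single_eq_single hβ ⟨0, hd1⟩ i]
    exact twoPointFree_diagAxis_le_of_mem_sphere' hβ hd1 (self_mem_sphere y)
  have hsum : Summable fun x => G x ^ 2 := by
    have hne : ∑' x, ENNReal.ofReal (G x ^ 2) ≠ ∞ := by
      have : ∑' x, ENNReal.ofReal (G x ^ 2) = ∑' x, ENNReal.ofReal (G x) ^ 2 :=
        tsum_congr fun x => by rw [ENNReal.ofReal_pow (hG0 x)]
      rw [this]; exact hB.ne
    exact (ENNReal.summable_toReal hne).congr fun x => ENNReal.toReal_ofReal (sq_nonneg _)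
  rcases hd with rfl | rfl
  · exact DCPBubble.not_summable_sq_three hG0 hG1 hGev hmono (fun y => by exact_mod_cast hsph y) hgrad hrefl hsum
  · exact DCPBubble.not_summable_sq_four hG0 hG1 hGev hmono (fun y => by exact_mod_cast hsph y) hgrad hrefl hsum

end NNIsing

end Literature.Barriers.CriticalPhenomena
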